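import Summits.HodgeConjecture.HodgeConjecture.Cruxes.BlochSeedDiscOne.DepthBoundA4

/-!
# RingFiveEmpty — RING 5 IS EMPTY in the kernel: `RingsEmpty 14 B rmin 5` for every budget `B ≤ 199` and every rank floor
(gs-eng-2 g59; v2 = the finite checks run over SORTED class tuples, see `forall_of_sorted4` — same theorems and certificates as v1 591d4aad45bdc945, ≈ 3× faster to elaborate).  Nineteen LP certificates + one `μ`-certificate, all found by this seat's exact LP (`work/ring5/fam5.py`, `cert5.py`) and
checked HERE by `decide`; the branch scheme (three maxima) is new — the published ring-5 numerics (plan-lens-HodgeAV-extremal g7 §5: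
family-(A4) branch-and-bound, 13 185 nodes, weakest leaf 199.073) used generic branching.

Token: line stmt-HodgeConjecture-18881 Cruxes/BlochSeedDiscOne/Lines/birth.lean 814a6a70c14e831a stub_rung_pad4_seedAt.

THE ARGUMENT (data model of `DepthBoundA4`, height 14, all supported letters of co-level ≤ 5).
* P-letters are off-axis, so `(a; |x|, |y|)` is one of ten shapes in six classes `A (12;1,1), B (11;2,1)~, C (10;3,1)~, D (10;2,2),
  E (9;4,1)~, F (9;3,2)~`; N-letters have co-level ≤ 3: `H, X13, X12, Q (12;1,1), X11 (11;3,0)~, NB (11;2,1)~`.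
* COVER LEMMAS (the only ample covers inside the alphabet): below a `Q` letter sits a `D` or an `F` letter, below an `NB` letter an `F`
  letter, below an `X11` letter an `E` letter.  Hence along a live arrow `x → y`: `#X11(y) ≤ #E(x)`, `#NB(y) ≤ #F(x)`,
  `#(Q ∪ NB)(y) ≤ #(D ∪ F)(x)`.
* THREE MAXIMA over supported P-cells: `kE = max #E`, `kF = max #F`, `kDF = max #(D ∪ F)` (each attained, `kF ≤ kDF`).  Every supported
  P-cell has `#E ≤ kE, #F ≤ kF, #DF ≤ kDF`, every supported N-cell `#X11 ≤ kE, #NB ≤ kF, #QNB ≤ kDF`, and the P-mass on cells with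
  `#F = kF` (resp. `#DF = kDF`, `#E = kE`) is `≥ 1`.
* Per branch an e-free functional `G = Σ_r g_r ρ_r` (six `S₄`-symmetric rows of degrees 2–6, killed by (A1): `G_vanishes`) with `G ≤ L` on
  the admissible N class-tuples and `−G + YE·[#E = kE] + YF·[#F = kF] + YDF·[#DF = kDF] ≤ L` on the admissible P class-tuples
  (`decide` over the SORTED class 4-tuples — 126 of `6⁴` per side, enough by slot symmetry, `forall_of_sorted4`) gives `YE + YF + YDF ≤ L·M`, and every certificate has `YE + YF + YDF > 199·L`.  Thirteen branches
  `(kF, kDF) ≠ (0,0), (3,4)` need no `E`-information (`kE := 4`, `YE = 0`); `(3,4)` is split on `kE ∈ {0,…,4}`; `(0,0)` (no `D`, no `F`,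
  hence no `Q`, no `NB`: all N-letters on the axes) is the `μ`-branch: `G ≥ L·∏|β|` on N, `G ≤ 0 ∧ G² ≥ L²∏b` on P, so
  `L·|Re μ|, L·|Im μ| ≤ Σ_N mG − Σ_P mG = 0`, i.e. `μ = 0`.  The rank hypothesis is idle; `μ ≠ 0` is used only in the `μ`-branch.
* LP values (min M of the class-tuple relaxation; ∞ = infeasible): (kF,kDF) = (0,1) ∞ · (0,2) 1218 · (0,3) 899.6 · (0,4) 2009.7 ·
  (1,1) ∞ · (1,2) 439.1 · (1,3) 322.9 · (1,4) 566.5 · (2,2) 353.3 · (2,3) 275.0 · (2,4) 241.1 · (3,3) 254.8 · (4,4) 251.9 ·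
  (kE,3,4) = 206.1 ∕ 199.079 ∕ 200.59 ∕ 224.9 ∕ 378.1 for kE = 0..4.  KNIFE-EDGE: (1,3,4) = 1110065∕5576 ≈ 199.079, so `B = 200`
  is not covered; the theorem is stated for `B ≤ 199` (the budget of record).
Consequences: `ringsEmpty_colevel_five`, `ringsEmpty_14_199_8_5 : RingsEmpty 14 199 8 5`, `a4_closed_of_depthBound_five`: the FALLBACK
target `DepthBound 14 199 8 5` (director l.8748 «DepthBound ∧ RingsEmpty at c₀ ≤ 5») alone closes the widened (A4) road.
§0–§2 (bookkeeping, the 71 e-free words, `Gcell`, `G_vanishes`) are VERBATIM the same as in `RingFourEmpty.lean` (gs-eng-2 g59), re-declared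
in this namespace so that the file imports `DepthBoundA4` only (neither ring file is a prerequisite of the other).
No `axiom` ∕ `instance` ∕ `sorry` ∕ `native_decide`; every finite check is a `Bool` evaluated by `decide`.
Chern-character words on a letter model ≠ sheaves ≠ the kernel of a SEED; nothing here is proved toward HC/HC_CM/HC_AV/№4/26512/18881/H2.
-/

set_option linter.dupNamespace false
set_option autoImplicit false

namespace Summit.HodgeConjecture.HodgeConjecture.Cruxes.BlochSeedDiscOne.RingFiveEmpty

open Summit.HodgeConjecture.HodgeConjecture.Cruxes.BlochSeedDiscOne.DepthBoundA4

/-! ## §0 Weighted-sum bookkeeping (`linZ L φ = Σ_{(c,m) ∈ L} m·φ(c)`) -/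

theorem linZ_add (L : List (Cell × ℕ)) (φ ψ : Cell → ℤ) :
    linZ L (fun c => φ c + ψ c) = linZ L φ + linZ L ψ := by
  induction L with
  | nil => simp [linZ]
  | cons a t ih => simp only [linZ_cons]; rw [ih]; ring

theorem linZ_smul (L : List (Cell × ℕ)) (r : ℤ) (φ : Cell → ℤ) :
    linZ L (fun c => r * φ c) = r * linZ L φ := by
  induction L with
  | nil => simp [linZ]
  | cons a t ih => simp only [linZ_cons]; rw [ih]; ring

theorem linZ_mono (L : List (Cell × ℕ)) (φ ψ : Cell → ℤ) (h : ∀ cm ∈ L, 0 < cm.2 → φ cm.1 ≤ ψ cm.1) :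
    linZ L φ ≤ linZ L ψ := by
  induction L with
  | nil => simp [linZ]
  | cons a t ih =>
    rw [linZ_cons, linZ_cons]
    have ht := ih fun cm hcm => h cm (List.mem_cons_of_mem _ hcm)
    rcases Nat.eq_zero_or_pos a.2 with h0 | hpos
    · rw [h0, Nat.cast_zero, zero_mul, zero_mul]
      linarith
    · have ha := h a List.mem_cons_self hpos
      have hm : (0 : ℤ) ≤ (a.2 : ℤ) := by exact_mod_cast Nat.zero_le _
      nlinarith

theorem abs_linZ_le (L : List (Cell × ℕ)) (φ : Cell → ℤ) : |linZ L φ| ≤ linZ L (fun c => |φ c|) := by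
  induction L with
  | nil => simp [linZ]
  | cons a t ih =>
    rw [linZ_cons, linZ_cons]
    have hm : (0 : ℤ) ≤ (a.2 : ℤ) := by exact_mod_cast Nat.zero_le _
    calc |(a.2 : ℤ) * φ a.1 + linZ t φ| ≤ |(a.2 : ℤ) * φ a.1| + |linZ t φ| := abs_add_le _ _
      _ = (a.2 : ℤ) * |φ a.1| + |linZ t φ| := by rw [abs_mul, abs_of_nonneg hm]
      _ ≤ (a.2 : ℤ) * |φ a.1| + linZ t (fun c => |φ c|) := by linarith

theorem term_le_linZ (L : List (Cell × ℕ)) (φ : Cell → ℤ) (hφ : ∀ c, 0 ≤ φ c) (c : Cell) (m : ℕ) (hmem : (c, m) ∈ L) :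
    (m : ℤ) * φ c ≤ linZ L φ := by
  induction L with
  | nil => simp at hmem
  | cons a t ih =>
    rw [linZ_cons]
    have ht0 : 0 ≤ linZ t φ := linZ_nonneg t φ fun cm _ _ => hφ cm.1
    have ha0 : 0 ≤ (a.2 : ℤ) * φ a.1 := mul_nonneg (by exact_mod_cast Nat.zero_le _) (hφ a.1)
    rcases List.mem_cons.mp hmem with heq | hmem'
    · rw [← heq]
      linarith
    · have := ih hmem'
      linarith

theorem re_linG (L : List (Cell × ℕ)) (u : Cell → GaussianInt) : (linG L u).re = linZ L (fun c => (u c).re) := by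
  induction L with
  | nil => simp [linG, linZ]
  | cons a t ih => rw [linG_cons, linZ_cons, Zsqrtd.re_add, ih]; simp [Zsqrtd.re_natCast]

theorem im_linG (L : List (Cell × ℕ)) (u : Cell → GaussianInt) : (linG L u).im = linZ L (fun c => (u c).im) := by
  induction L with
  | nil => simp [linG, linZ]
  | cons a t ih => rw [linG_cons, linZ_cons, Zsqrtd.im_add, ih]; simp [Zsqrtd.im_natCast, Zsqrtd.re_natCast]

/-! ## §1 The 71 e-free words of degrees 2–6, grouped by `S₄`-orbit, and the orbit sums -/

/-- `Bool` form of `Word.efree` (decidable by evaluation). -/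
def efreeB (w : Word) : Bool := (w 0).efree && (w 1).efree && (w 2).efree && (w 3).efree

theorem efree_of_efreeB (w : Word) (h : efreeB w = true) : w.efree := by
  intro f
  simp only [efreeB, Bool.and_eq_true] at h
  obtain ⟨⟨⟨h0, h1⟩, h2⟩, h3⟩ := h
  fin_cases f <;> assumption

/-- the 6 e-free words of type `HH` (degree 2) -/
def wordsHH : List Word :=
  [![Sym.one, Sym.one, Sym.h, Sym.h], ![Sym.one, Sym.h, Sym.one, Sym.h], ![Sym.one, Sym.h, Sym.h, Sym.one],
   ![Sym.h, Sym.one, Sym.one, Sym.h], ![Sym.h, Sym.one, Sym.h, Sym.one], ![Sym.h, Sym.h, Sym.one, Sym.one]]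
set_option maxRecDepth 20000 in
theorem wordsHH_ok : ∀ w ∈ wordsHH, efreeB w = true ∧ Word.deg w = 2 := by decide
theorem wordsHH_length : wordsHH.length = 6 := rfl

/-- the 4 e-free words of type `P` (degree 2) -/
def wordsP : List Word :=
  [![Sym.one, Sym.one, Sym.one, Sym.pt], ![Sym.one, Sym.one, Sym.pt, Sym.one], ![Sym.one, Sym.pt, Sym.one, Sym.one],
   ![Sym.pt, Sym.one, Sym.one, Sym.one]]
set_option maxRecDepth 20000 in
theorem wordsP_ok : ∀ w ∈ wordsP, efreeB w = true ∧ Word.deg w = 2 := by decide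
theorem wordsP_length : wordsP.length = 4 := rfl

/-- the 4 e-free words of type `HHH` (degree 3) -/
def wordsHHH : List Word :=
  [![Sym.one, Sym.h, Sym.h, Sym.h], ![Sym.h, Sym.one, Sym.h, Sym.h], ![Sym.h, Sym.h, Sym.one, Sym.h],
   ![Sym.h, Sym.h, Sym.h, Sym.one]]
set_option maxRecDepth 20000 in
theorem wordsHHH_ok : ∀ w ∈ wordsHHH, efreeB w = true ∧ Word.deg w = 3 := by decide
theorem wordsHHH_length : wordsHHH.length = 4 := rfl

/-- the 12 e-free words of type `PH` (degree 3) -/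
def wordsPH : List Word :=
  [![Sym.one, Sym.one, Sym.h, Sym.pt], ![Sym.one, Sym.one, Sym.pt, Sym.h], ![Sym.one, Sym.h, Sym.one, Sym.pt],
   ![Sym.one, Sym.h, Sym.pt, Sym.one], ![Sym.one, Sym.pt, Sym.one, Sym.h], ![Sym.one, Sym.pt, Sym.h, Sym.one],
   ![Sym.h, Sym.one, Sym.one, Sym.pt], ![Sym.h, Sym.one, Sym.pt, Sym.one], ![Sym.h, Sym.pt, Sym.one, Sym.one],
   ![Sym.pt, Sym.one, Sym.one, Sym.h], ![Sym.pt, Sym.one, Sym.h, Sym.one], ![Sym.pt, Sym.h, Sym.one, Sym.one]]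
set_option maxRecDepth 20000 in
theorem wordsPH_ok : ∀ w ∈ wordsPH, efreeB w = true ∧ Word.deg w = 3 := by decide
theorem wordsPH_length : wordsPH.length = 12 := rfl

/-- the 1 e-free words of type `HHHH` (degree 4) -/
def wordsHHHH : List Word :=
  [![Sym.h, Sym.h, Sym.h, Sym.h]]
set_option maxRecDepth 20000 in
theorem wordsHHHH_ok : ∀ w ∈ wordsHHHH, efreeB w = true ∧ Word.deg w = 4 := by decide
theorem wordsHHHH_length : wordsHHHH.length = 1 := rfl

/-- the 12 e-free words of type `PHH` (degree 4) -/
def wordsPHH : List Word :=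
  [![Sym.one, Sym.h, Sym.h, Sym.pt], ![Sym.one, Sym.h, Sym.pt, Sym.h], ![Sym.one, Sym.pt, Sym.h, Sym.h],
   ![Sym.h, Sym.one, Sym.h, Sym.pt], ![Sym.h, Sym.one, Sym.pt, Sym.h], ![Sym.h, Sym.h, Sym.one, Sym.pt],
   ![Sym.h, Sym.h, Sym.pt, Sym.one], ![Sym.h, Sym.pt, Sym.one, Sym.h], ![Sym.h, Sym.pt, Sym.h, Sym.one],
   ![Sym.pt, Sym.one, Sym.h, Sym.h], ![Sym.pt, Sym.h, Sym.one, Sym.h], ![Sym.pt, Sym.h, Sym.h, Sym.one]]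
set_option maxRecDepth 20000 in
theorem wordsPHH_ok : ∀ w ∈ wordsPHH, efreeB w = true ∧ Word.deg w = 4 := by decide
theorem wordsPHH_length : wordsPHH.length = 12 := rfl

/-- the 6 e-free words of type `PP` (degree 4) -/
def wordsPP : List Word :=
  [![Sym.one, Sym.one, Sym.pt, Sym.pt], ![Sym.one, Sym.pt, Sym.one, Sym.pt], ![Sym.one, Sym.pt, Sym.pt, Sym.one],
   ![Sym.pt, Sym.one, Sym.one, Sym.pt], ![Sym.pt, Sym.one, Sym.pt, Sym.one], ![Sym.pt, Sym.pt, Sym.one, Sym.one]]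
set_option maxRecDepth 20000 in
theorem wordsPP_ok : ∀ w ∈ wordsPP, efreeB w = true ∧ Word.deg w = 4 := by decide
theorem wordsPP_length : wordsPP.length = 6 := rfl

/-- the 4 e-free words of type `PHHH` (degree 5) -/
def wordsPHHH : List Word :=
  [![Sym.h, Sym.h, Sym.h, Sym.pt], ![Sym.h, Sym.h, Sym.pt, Sym.h], ![Sym.h, Sym.pt, Sym.h, Sym.h],
   ![Sym.pt, Sym.h, Sym.h, Sym.h]]
set_option maxRecDepth 20000 in
theorem wordsPHHH_ok : ∀ w ∈ wordsPHHH, efreeB w = true ∧ Word.deg w = 5 := by decide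
theorem wordsPHHH_length : wordsPHHH.length = 4 := rfl

/-- the 12 e-free words of type `PPH` (degree 5) -/
def wordsPPH : List Word :=
  [![Sym.one, Sym.h, Sym.pt, Sym.pt], ![Sym.one, Sym.pt, Sym.h, Sym.pt], ![Sym.one, Sym.pt, Sym.pt, Sym.h],
   ![Sym.h, Sym.one, Sym.pt, Sym.pt], ![Sym.h, Sym.pt, Sym.one, Sym.pt], ![Sym.h, Sym.pt, Sym.pt, Sym.one],
   ![Sym.pt, Sym.one, Sym.h, Sym.pt], ![Sym.pt, Sym.one, Sym.pt, Sym.h], ![Sym.pt, Sym.h, Sym.one, Sym.pt],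
   ![Sym.pt, Sym.h, Sym.pt, Sym.one], ![Sym.pt, Sym.pt, Sym.one, Sym.h], ![Sym.pt, Sym.pt, Sym.h, Sym.one]]
set_option maxRecDepth 20000 in
theorem wordsPPH_ok : ∀ w ∈ wordsPPH, efreeB w = true ∧ Word.deg w = 5 := by decide
theorem wordsPPH_length : wordsPPH.length = 12 := rfl

/-- the 6 e-free words of type `PPHH` (degree 6) -/
def wordsPPHH : List Word :=
  [![Sym.h, Sym.h, Sym.pt, Sym.pt], ![Sym.h, Sym.pt, Sym.h, Sym.pt], ![Sym.h, Sym.pt, Sym.pt, Sym.h],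
   ![Sym.pt, Sym.h, Sym.h, Sym.pt], ![Sym.pt, Sym.h, Sym.pt, Sym.h], ![Sym.pt, Sym.pt, Sym.h, Sym.h]]
set_option maxRecDepth 20000 in
theorem wordsPPHH_ok : ∀ w ∈ wordsPPHH, efreeB w = true ∧ Word.deg w = 6 := by decide
theorem wordsPPHH_length : wordsPPHH.length = 6 := rfl

/-- the 4 e-free words of type `PPP` (degree 6) -/
def wordsPPP : List Word :=
  [![Sym.one, Sym.pt, Sym.pt, Sym.pt], ![Sym.pt, Sym.one, Sym.pt, Sym.pt], ![Sym.pt, Sym.pt, Sym.one, Sym.pt],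
   ![Sym.pt, Sym.pt, Sym.pt, Sym.one]]
set_option maxRecDepth 20000 in
theorem wordsPPP_ok : ∀ w ∈ wordsPPP, efreeB w = true ∧ Word.deg w = 6 := by decide
theorem wordsPPP_length : wordsPPP.length = 4 := rfl



/-- Orbit sum: `Σ_{w ∈ ws} icellCoef c w`. -/
def SO (ws : List Word) (c : Cell) : ℤ := (ws.map fun w => icellCoef c w).sum

theorem SO_nil (c : Cell) : SO [] c = 0 := rfl

theorem SO_cons (w : Word) (ws : List Word) (c : Cell) : SO (w :: ws) c = icellCoef c w + SO ws c := by
  simp [SO]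

/-- Under (A1), the row of one orbit: `Σ_N m·SO − Σ_P m·SO = |orbit| · Tz(reference word of that degree)`. -/
theorem orbit_row (D : Design) (h1 : D.A1) (ref : Word) (href : efreeB ref = true) (d : ℕ) (hd : ref.deg = d)
    (ws : List Word) (hws : ∀ w ∈ ws, efreeB w = true ∧ Word.deg w = d) :
    linZ D.N (SO ws) - linZ D.P (SO ws) = (ws.length : ℤ) * D.Tz ref := by
  induction ws with
  | nil => simp [SO, linZ]
  | cons w t ih =>
    have hw := hws w List.mem_cons_self
    have ht := ih fun w' hw' => hws w' (List.mem_cons_of_mem _ hw')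
    have hTz : D.Tz w = D.Tz ref :=
      Tz_eq_of_A1 D h1 w ref (efree_of_efreeB w hw.1) (efree_of_efreeB ref href) (hw.2.trans hd.symm)
    have eN : linZ D.N (SO (w :: t)) = linZ D.N (fun c => icellCoef c w) + linZ D.N (SO t) := by
      rw [← linZ_add]; rfl
    have eP : linZ D.P (SO (w :: t)) = linZ D.P (fun c => icellCoef c w) + linZ D.P (SO t) := by
      rw [← linZ_add]; rfl
    rw [eN, eP, List.length_cons, Nat.cast_succ]
    unfold Design.Tz at hTz ht ⊢
    linear_combination hTz + ht

/-! ### The eleven orbit polynomials in the levels `a_f` and the `pt`-coefficients `n_f = a_f² − b_f` -/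

/-- `e₂(a)` -/
def oHH (a0 _n0 a1 _n1 a2 _n2 a3 _n3 : ℤ) : ℤ := a0*a1 + a0*a2 + a0*a3 + a1*a2 + a1*a3 + a2*a3
/-- `Σ n` -/
def oP (_a0 n0 _a1 n1 _a2 n2 _a3 n3 : ℤ) : ℤ := n0 + n1 + n2 + n3
/-- `e₃(a)` -/
def oHHH (a0 _n0 a1 _n1 a2 _n2 a3 _n3 : ℤ) : ℤ := a0*a1*a2 + a0*a1*a3 + a0*a2*a3 + a1*a2*a3
/-- `Σ_{f ≠ g} n_f a_g` -/
def oPH (a0 n0 a1 n1 a2 n2 a3 n3 : ℤ) : ℤ := n0*(a1+a2+a3) + n1*(a0+a2+a3) + n2*(a0+a1+a3) + n3*(a0+a1+a2)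
/-- `e₄(a)` -/
def oHHHH (a0 _n0 a1 _n1 a2 _n2 a3 _n3 : ℤ) : ℤ := a0*a1*a2*a3
/-- `Σ_f n_f e₂(a_{≠f})` -/
def oPHH (a0 n0 a1 n1 a2 n2 a3 n3 : ℤ) : ℤ :=
  n0*(a1*a2 + a1*a3 + a2*a3) + n1*(a0*a2 + a0*a3 + a2*a3) + n2*(a0*a1 + a0*a3 + a1*a3) + n3*(a0*a1 + a0*a2 + a1*a2)
/-- `e₂(n)` -/
def oPP (_a0 n0 _a1 n1 _a2 n2 _a3 n3 : ℤ) : ℤ := n0*n1 + n0*n2 + n0*n3 + n1*n2 + n1*n3 + n2*n3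
/-- `Σ_f n_f e₃(a_{≠f})` -/
def oPHHH (a0 n0 a1 n1 a2 n2 a3 n3 : ℤ) : ℤ := n0*a1*a2*a3 + n1*a0*a2*a3 + n2*a0*a1*a3 + n3*a0*a1*a2
/-- `Σ_{f<g} n_f n_g e₁(a_{≠f,g})` -/
def oPPH (a0 n0 a1 n1 a2 n2 a3 n3 : ℤ) : ℤ :=
  n0*n1*(a2+a3) + n0*n2*(a1+a3) + n0*n3*(a1+a2) + n1*n2*(a0+a3) + n1*n3*(a0+a2) + n2*n3*(a0+a1)
/-- `Σ_{f<g} n_f n_g e₂(a_{≠f,g})` -/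
def oPPHH (a0 n0 a1 n1 a2 n2 a3 n3 : ℤ) : ℤ := n0*n1*a2*a3 + n0*n2*a1*a3 + n0*n3*a1*a2 + n1*n2*a0*a3 + n1*n3*a0*a2 + n2*n3*a0*a1
/-- `e₃(n)` -/
def oPPP (_a0 n0 _a1 n1 _a2 n2 _a3 n3 : ℤ) : ℤ := n0*n1*n2 + n0*n1*n3 + n0*n2*n3 + n1*n2*n3

theorem SO_HH (c : Cell) : SO wordsHH c =
    oHH (c 0).a (c 0).selfInt (c 1).a (c 1).selfInt (c 2).a (c 2).selfInt (c 3).a (c 3).selfInt := by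
  simp [SO, wordsHH, icellCoef, Fin.prod_univ_four, Sym.icoef, oHH]; ring
theorem SO_P (c : Cell) : SO wordsP c =
    oP (c 0).a (c 0).selfInt (c 1).a (c 1).selfInt (c 2).a (c 2).selfInt (c 3).a (c 3).selfInt := by
  simp [SO, wordsP, icellCoef, Fin.prod_univ_four, Sym.icoef, oP]; ring
theorem SO_HHH (c : Cell) : SO wordsHHH c =
    oHHH (c 0).a (c 0).selfInt (c 1).a (c 1).selfInt (c 2).a (c 2).selfInt (c 3).a (c 3).selfInt := by
  simp [SO, wordsHHH, icellCoef, Fin.prod_univ_four, Sym.icoef, oHHH]; ring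
theorem SO_PH (c : Cell) : SO wordsPH c =
    oPH (c 0).a (c 0).selfInt (c 1).a (c 1).selfInt (c 2).a (c 2).selfInt (c 3).a (c 3).selfInt := by
  simp [SO, wordsPH, icellCoef, Fin.prod_univ_four, Sym.icoef, oPH]; ring
theorem SO_HHHH (c : Cell) : SO wordsHHHH c =
    oHHHH (c 0).a (c 0).selfInt (c 1).a (c 1).selfInt (c 2).a (c 2).selfInt (c 3).a (c 3).selfInt := by
  simp [SO, wordsHHHH, icellCoef, Fin.prod_univ_four, Sym.icoef, oHHHH]
theorem SO_PHH (c : Cell) : SO wordsPHH c =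
    oPHH (c 0).a (c 0).selfInt (c 1).a (c 1).selfInt (c 2).a (c 2).selfInt (c 3).a (c 3).selfInt := by
  simp [SO, wordsPHH, icellCoef, Fin.prod_univ_four, Sym.icoef, oPHH]; ring
theorem SO_PP (c : Cell) : SO wordsPP c =
    oPP (c 0).a (c 0).selfInt (c 1).a (c 1).selfInt (c 2).a (c 2).selfInt (c 3).a (c 3).selfInt := by
  simp [SO, wordsPP, icellCoef, Fin.prod_univ_four, Sym.icoef, oPP]; ring
theorem SO_PHHH (c : Cell) : SO wordsPHHH c =
    oPHHH (c 0).a (c 0).selfInt (c 1).a (c 1).selfInt (c 2).a (c 2).selfInt (c 3).a (c 3).selfInt := by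
  simp [SO, wordsPHHH, icellCoef, Fin.prod_univ_four, Sym.icoef, oPHHH]; ring
theorem SO_PPH (c : Cell) : SO wordsPPH c =
    oPPH (c 0).a (c 0).selfInt (c 1).a (c 1).selfInt (c 2).a (c 2).selfInt (c 3).a (c 3).selfInt := by
  simp [SO, wordsPPH, icellCoef, Fin.prod_univ_four, Sym.icoef, oPPH]; ring
theorem SO_PPHH (c : Cell) : SO wordsPPHH c =
    oPPHH (c 0).a (c 0).selfInt (c 1).a (c 1).selfInt (c 2).a (c 2).selfInt (c 3).a (c 3).selfInt := by
  simp [SO, wordsPPHH, icellCoef, Fin.prod_univ_four, Sym.icoef, oPPHH]; ring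
theorem SO_PPP (c : Cell) : SO wordsPPP c =
    oPPP (c 0).a (c 0).selfInt (c 1).a (c 1).selfInt (c 2).a (c 2).selfInt (c 3).a (c 3).selfInt := by
  simp [SO, wordsPPP, icellCoef, Fin.prod_univ_four, Sym.icoef, oPPP]; ring

/-! ## §2 The functional `G = Σ_r g_r ρ_r` and its (A1)-vanishing -/

/-- Six row multipliers (for `ρ₂, ρ₃, ρ₄a, ρ₄b, ρ₅, ρ₆`). -/
structure Coefs where
  g2 : ℤ
  g3 : ℤ
  g4 : ℤ
  g5 : ℤ
  g6 : ℤ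
  g7 : ℤ

/-- `G` as a polynomial in the class data `(a_f, n_f)`; the rows are `ρ₂ = 2e₂(a) − 3Σn` (= `4·[hh] − 6·[pt]` over orderings), `ρ₃ = 3e₃(a) − Σ_{f≠g} n_f a_g`,
`ρ₄a = 12e₄(a) − Σ n_f e₂(a_{≠f})`, `ρ₄b = Σ n_f e₂(a_{≠f}) − 2e₂(n)`, `ρ₅ = 3Σ n_f e₃(a_{≠f}) − Σ n_f n_g e₁`, `ρ₆ = 2Σ n_f n_g e₂ − 3e₃(n)` —
each `|O′|·(orbit O) − |O|·(orbit O′)` for two orbits of one degree, divided by the gcd. -/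
def Gpoly (γ : Coefs) (a0 n0 a1 n1 a2 n2 a3 n3 : ℤ) : ℤ :=
  γ.g2 * (2 * oHH a0 n0 a1 n1 a2 n2 a3 n3 - 3 * oP a0 n0 a1 n1 a2 n2 a3 n3)
  + γ.g3 * (3 * oHHH a0 n0 a1 n1 a2 n2 a3 n3 - oPH a0 n0 a1 n1 a2 n2 a3 n3)
  + γ.g4 * (12 * oHHHH a0 n0 a1 n1 a2 n2 a3 n3 - oPHH a0 n0 a1 n1 a2 n2 a3 n3)
  + γ.g5 * (oPHH a0 n0 a1 n1 a2 n2 a3 n3 - 2 * oPP a0 n0 a1 n1 a2 n2 a3 n3)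
  + γ.g6 * (3 * oPHHH a0 n0 a1 n1 a2 n2 a3 n3 - oPPH a0 n0 a1 n1 a2 n2 a3 n3)
  + γ.g7 * (2 * oPPHH a0 n0 a1 n1 a2 n2 a3 n3 - 3 * oPPP a0 n0 a1 n1 a2 n2 a3 n3)

/-- `G` of a cell. -/
def Gcell (γ : Coefs) (c : Cell) : ℤ :=
  Gpoly γ (c 0).a (c 0).selfInt (c 1).a (c 1).selfInt (c 2).a (c 2).selfInt (c 3).a (c 3).selfInt

theorem Gcell_eq (γ : Coefs) (c : Cell) : Gcell γ c =
    γ.g2 * (2 * SO wordsHH c - 3 * SO wordsP c) + γ.g3 * (3 * SO wordsHHH c - SO wordsPH c)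
    + γ.g4 * (12 * SO wordsHHHH c - SO wordsPHH c) + γ.g5 * (SO wordsPHH c - 2 * SO wordsPP c)
    + γ.g6 * (3 * SO wordsPHHH c - SO wordsPPH c) + γ.g7 * (2 * SO wordsPPHH c - 3 * SO wordsPPP c) := by
  rw [SO_HH, SO_P, SO_HHH, SO_PH, SO_HHHH, SO_PHH, SO_PP, SO_PHHH, SO_PPH, SO_PPHH, SO_PPP]
  rfl

theorem linZ_Gcell (L : List (Cell × ℕ)) (γ : Coefs) : linZ L (Gcell γ) =
    γ.g2 * (2 * linZ L (SO wordsHH) - 3 * linZ L (SO wordsP)) + γ.g3 * (3 * linZ L (SO wordsHHH) - linZ L (SO wordsPH))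
    + γ.g4 * (12 * linZ L (SO wordsHHHH) - linZ L (SO wordsPHH)) + γ.g5 * (linZ L (SO wordsPHH) - 2 * linZ L (SO wordsPP))
    + γ.g6 * (3 * linZ L (SO wordsPHHH) - linZ L (SO wordsPPH)) + γ.g7 * (2 * linZ L (SO wordsPPHH) - 3 * linZ L (SO wordsPPP)) := by
  induction L with
  | nil => simp [linZ]
  | cons a t ih => simp only [linZ_cons]; rw [ih, Gcell_eq]; ring

/-- reference words, one per degree -/
def ref2 : Word := ![Sym.pt, Sym.one, Sym.one, Sym.one]
/-- degree 3 -/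
def ref3 : Word := ![Sym.h, Sym.h, Sym.h, Sym.one]
/-- degree 4 -/
def ref4 : Word := ![Sym.h, Sym.h, Sym.h, Sym.h]
/-- degree 5 -/
def ref5 : Word := ![Sym.pt, Sym.h, Sym.h, Sym.h]
/-- degree 6 -/
def ref6 : Word := ![Sym.pt, Sym.pt, Sym.h, Sym.h]

/-- **(A1) kills every functional of this shape**: `Σ_N m·G − Σ_P m·G = 0`. -/
theorem G_vanishes (D : Design) (h1 : D.A1) (γ : Coefs) : linZ D.N (Gcell γ) - linZ D.P (Gcell γ) = 0 := by
  have rHH := orbit_row D h1 ref2 (by decide) 2 (by decide) wordsHH wordsHH_ok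
  have rP := orbit_row D h1 ref2 (by decide) 2 (by decide) wordsP wordsP_ok
  have rHHH := orbit_row D h1 ref3 (by decide) 3 (by decide) wordsHHH wordsHHH_ok
  have rPH := orbit_row D h1 ref3 (by decide) 3 (by decide) wordsPH wordsPH_ok
  have rHHHH := orbit_row D h1 ref4 (by decide) 4 (by decide) wordsHHHH wordsHHHH_ok
  have rPHH := orbit_row D h1 ref4 (by decide) 4 (by decide) wordsPHH wordsPHH_ok
  have rPP := orbit_row D h1 ref4 (by decide) 4 (by decide) wordsPP wordsPP_ok
  have rPHHH := orbit_row D h1 ref5 (by decide) 5 (by decide) wordsPHHH wordsPHHH_ok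
  have rPPH := orbit_row D h1 ref5 (by decide) 5 (by decide) wordsPPH wordsPPH_ok
  have rPPHH := orbit_row D h1 ref6 (by decide) 6 (by decide) wordsPPHH wordsPPHH_ok
  have rPPP := orbit_row D h1 ref6 (by decide) 6 (by decide) wordsPPP wordsPPP_ok
  rw [wordsHH_length] at rHH; rw [wordsP_length] at rP; rw [wordsHHH_length] at rHHH; rw [wordsPH_length] at rPH
  rw [wordsHHHH_length] at rHHHH; rw [wordsPHH_length] at rPHH; rw [wordsPP_length] at rPP; rw [wordsPHHH_length] at rPHHH
  rw [wordsPPH_length] at rPPH; rw [wordsPPHH_length] at rPPHH; rw [wordsPPP_length] at rPPP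
  rw [linZ_Gcell, linZ_Gcell]
  push_cast at *
  linear_combination γ.g2 * (2 * rHH - 3 * rP) + γ.g3 * (3 * rHHH - rPH) + γ.g4 * (12 * rHHHH - rPHH)
    + γ.g5 * (rPHH - 2 * rPP) + γ.g6 * (3 * rPHHH - rPPH) + γ.g7 * (2 * rPPHH - 3 * rPPP)

/-! ## §3 Letter classes at co-level ≤ 5, their class data, and the finite checks (`Bool`, evaluated by `decide`) -/

/-- P-letter classes: `A = (12;1,1)`, `B = (11;2,1)~`, `C = (10;3,1)~`, `D = (10;2,2)`, `E = (9;4,1)~`, `F = (9;3,2)~` (`~` = either order). -/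
inductive PC5 where
  | A | B | C | D | E | F
deriving DecidableEq, Repr

/-- level `a` -/
def PC5.av : PC5 → ℤ
  | A => 12 | B => 11 | C => 10 | D => 10 | E => 9 | F => 9
/-- `n = a² − b` -/
def PC5.nv : PC5 → ℤ
  | A => 142 | B => 116 | C => 90 | D => 92 | E => 64 | F => 68
/-- `b = |β|²` -/
def PC5.bv : PC5 → ℤ
  | A => 2 | B => 5 | C => 10 | D => 8 | E => 17 | F => 13
/-- the class `D` -/
def PC5.isD : PC5 → Bool
  | D => true | _ => false
/-- the class `E` -/
def PC5.isE : PC5 → Bool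
  | E => true | _ => false
/-- the class `F` -/
def PC5.isF : PC5 → Bool
  | F => true | _ => false
/-- enumeration index (for sorted tuples) -/
def PC5.idx : PC5 → ℕ
  | A => 0 | B => 1 | C => 2 | D => 3 | E => 4 | F => 5

/-- N-letter classes: `H = (14;0,0)`, `X13 = (13;1,0)~`, `X12 = (12;2,0)~`, `Q = (12;1,1)`, `X11 = (11;3,0)~`, `NB = (11;2,1)~`. -/
inductive NC5 where
  | H | X13 | X12 | Q | X11 | NB
deriving DecidableEq, Repr

/-- level `a` -/
def NC5.av : NC5 → ℤ
  | H => 14 | X13 => 13 | X12 => 12 | Q => 12 | X11 => 11 | NB => 11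
/-- `n = a² − b` -/
def NC5.nv : NC5 → ℤ
  | H => 196 | X13 => 168 | X12 => 140 | Q => 142 | X11 => 112 | NB => 116
/-- `|β|` for the axis classes (unused for `Q`, `NB`) -/
def NC5.sv : NC5 → ℤ
  | H => 0 | X13 => 1 | X12 => 2 | Q => 0 | X11 => 3 | NB => 0
/-- the class `Q` -/
def NC5.isQ : NC5 → Bool
  | Q => true | _ => false
/-- the class `X11` -/
def NC5.isX11 : NC5 → Bool
  | X11 => true | _ => false
/-- the class `NB` -/
def NC5.isNB : NC5 → Bool
  | NB => true | _ => false
/-- enumeration index (for sorted tuples) -/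
def NC5.idx : NC5 → ℕ
  | H => 0 | X13 => 1 | X12 => 2 | Q => 3 | X11 => 4 | NB => 5

theorem NC5.sv_nonneg (K : NC5) : 0 ≤ K.sv := by cases K <;> decide

/-- `∀` over `PC5` as a `Bool`. -/
def allPC5 (p : PC5 → Bool) : Bool := p PC5.A && p PC5.B && p PC5.C && p PC5.D && p PC5.E && p PC5.F
/-- `∀` over `NC5` as a `Bool`. -/
def allNC5 (p : NC5 → Bool) : Bool := p NC5.H && p NC5.X13 && p NC5.X12 && p NC5.Q && p NC5.X11 && p NC5.NB

theorem allPC5_spec (p : PC5 → Bool) (h : allPC5 p = true) (k : PC5) : p k = true := by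
  simp only [allPC5, Bool.and_eq_true] at h
  obtain ⟨⟨⟨⟨⟨hA, hB⟩, hC⟩, hD⟩, hE⟩, hF⟩ := h
  cases k <;> assumption

theorem allNC5_spec (p : NC5 → Bool) (h : allNC5 p = true) (k : NC5) : p k = true := by
  simp only [allNC5, Bool.and_eq_true] at h
  obtain ⟨⟨⟨⟨⟨hA, hB⟩, hC⟩, hD⟩, hE⟩, hF⟩ := h
  cases k <;> assumption

/-- SORTING PRINCIPLE for symmetric 4-ary predicates: if `P` is invariant under the three adjacent transpositions and holds on all
tuples sorted by `r`, it holds everywhere (64-way comparison split; each case closed by one of the 24 swap chains). -/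
theorem forall_of_sorted4 {α : Type} (r : α → ℕ) (P : α → α → α → α → Prop)
    (s01 : ∀ x y z w, P x y z w → P y x z w) (s12 : ∀ x y z w, P x y z w → P x z y w)
    (s23 : ∀ x y z w, P x y z w → P x y w z)
    (h : ∀ x y z w, r x ≤ r y → r y ≤ r z → r z ≤ r w → P x y z w) : ∀ a b c d, P a b c d := by
  intro a b c d
  rcases le_total (r a) (r b) with h1 | h1 <;> rcases le_total (r a) (r c) with h2 | h2 <;>
  rcases le_total (r a) (r d) with h3 | h3 <;> rcases le_total (r b) (r c) with h4 | h4 <;>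
  rcases le_total (r b) (r d) with h5 | h5 <;> rcases le_total (r c) (r d) with h6 | h6 <;>
    first
      | exact h _ _ _ _ (by omega) (by omega) (by omega)
      | exact s23 _ _ _ _ (h _ _ _ _ (by omega) (by omega) (by omega))
      | exact s12 _ _ _ _ (h _ _ _ _ (by omega) (by omega) (by omega))
      | exact s12 _ _ _ _ (s23 _ _ _ _ (h _ _ _ _ (by omega) (by omega) (by omega)))
      | exact s23 _ _ _ _ (s12 _ _ _ _ (h _ _ _ _ (by omega) (by omega) (by omega)))
      | exact s12 _ _ _ _ (s23 _ _ _ _ (s12 _ _ _ _ (h _ _ _ _ (by omega) (by omega) (by omega))))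
      | exact s01 _ _ _ _ (h _ _ _ _ (by omega) (by omega) (by omega))
      | exact s23 _ _ _ _ (s01 _ _ _ _ (h _ _ _ _ (by omega) (by omega) (by omega)))
      | exact s01 _ _ _ _ (s12 _ _ _ _ (h _ _ _ _ (by omega) (by omega) (by omega)))
      | exact s01 _ _ _ _ (s12 _ _ _ _ (s23 _ _ _ _ (h _ _ _ _ (by omega) (by omega) (by omega))))
      | exact s01 _ _ _ _ (s23 _ _ _ _ (s12 _ _ _ _ (h _ _ _ _ (by omega) (by omega) (by omega))))
      | exact s01 _ _ _ _ (s12 _ _ _ _ (s23 _ _ _ _ (s12 _ _ _ _ (h _ _ _ _ (by omega) (by omega) (by omega)))))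
      | exact s12 _ _ _ _ (s01 _ _ _ _ (h _ _ _ _ (by omega) (by omega) (by omega)))
      | exact s12 _ _ _ _ (s23 _ _ _ _ (s01 _ _ _ _ (h _ _ _ _ (by omega) (by omega) (by omega))))
      | exact s01 _ _ _ _ (s12 _ _ _ _ (s01 _ _ _ _ (h _ _ _ _ (by omega) (by omega) (by omega))))
      | exact s01 _ _ _ _ (s12 _ _ _ _ (s23 _ _ _ _ (s01 _ _ _ _ (h _ _ _ _ (by omega) (by omega) (by omega)))))
      | exact s12 _ _ _ _ (s01 _ _ _ _ (s23 _ _ _ _ (s12 _ _ _ _ (h _ _ _ _ (by omega) (by omega) (by omega)))))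
      | exact s01 _ _ _ _ (s12 _ _ _ _ (s01 _ _ _ _ (s23 _ _ _ _ (s12 _ _ _ _ (h _ _ _ _ (by omega) (by omega) (by omega))))))
      | exact s23 _ _ _ _ (s12 _ _ _ _ (s01 _ _ _ _ (h _ _ _ _ (by omega) (by omega) (by omega))))
      | exact s12 _ _ _ _ (s23 _ _ _ _ (s12 _ _ _ _ (s01 _ _ _ _ (h _ _ _ _ (by omega) (by omega) (by omega)))))
      | exact s01 _ _ _ _ (s23 _ _ _ _ (s12 _ _ _ _ (s01 _ _ _ _ (h _ _ _ _ (by omega) (by omega) (by omega)))))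
      | exact s01 _ _ _ _ (s12 _ _ _ _ (s23 _ _ _ _ (s12 _ _ _ _ (s01 _ _ _ _ (h _ _ _ _ (by omega) (by omega) (by omega))))))
      | exact s12 _ _ _ _ (s01 _ _ _ _ (s23 _ _ _ _ (s12 _ _ _ _ (s01 _ _ _ _ (h _ _ _ _ (by omega) (by omega) (by omega))))))
      | exact s01 _ _ _ _ (s12 _ _ _ _ (s01 _ _ _ _ (s23 _ _ _ _ (s12 _ _ _ _ (s01 _ _ _ _ (h _ _ _ _ (by omega) (by omega) (by omega)))))))

/-- `G` on a P class-tuple. -/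
def GP5 (γ : Coefs) (k0 k1 k2 k3 : PC5) : ℤ := Gpoly γ k0.av k0.nv k1.av k1.nv k2.av k2.nv k3.av k3.nv
/-- `G` on an N class-tuple. -/
def GN5 (γ : Coefs) (k0 k1 k2 k3 : NC5) : ℤ := Gpoly γ k0.av k0.nv k1.av k1.nv k2.av k2.nv k3.av k3.nv
/-- number of `D`-or-`F` slots -/
def cntDF (k0 k1 k2 k3 : PC5) : ℕ :=
  (k0.isD || k0.isF).toNat + (k1.isD || k1.isF).toNat + (k2.isD || k2.isF).toNat + (k3.isD || k3.isF).toNat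
/-- number of `E` slots -/
def cntE (k0 k1 k2 k3 : PC5) : ℕ := k0.isE.toNat + k1.isE.toNat + k2.isE.toNat + k3.isE.toNat
/-- number of `F` slots -/
def cntF (k0 k1 k2 k3 : PC5) : ℕ := k0.isF.toNat + k1.isF.toNat + k2.isF.toNat + k3.isF.toNat
/-- number of `Q`-or-`NB` slots -/
def cntQNB (k0 k1 k2 k3 : NC5) : ℕ :=
  (k0.isQ || k0.isNB).toNat + (k1.isQ || k1.isNB).toNat + (k2.isQ || k2.isNB).toNat + (k3.isQ || k3.isNB).toNat
/-- number of `X11` slots -/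
def cntX11 (k0 k1 k2 k3 : NC5) : ℕ := k0.isX11.toNat + k1.isX11.toNat + k2.isX11.toNat + k3.isX11.toNat
/-- number of `NB` slots -/
def cntNB (k0 k1 k2 k3 : NC5) : ℕ := k0.isNB.toNat + k1.isNB.toNat + k2.isNB.toNat + k3.isNB.toNat

/-! ### The four finite checks, as predicates on class tuples; the `Bool` versions run over SORTED tuples only (`idx` non-decreasing,
126 of 1 296), which is enough because every quantity involved is symmetric in the four slots. -/

/-- P-side predicate of branch `(kE, kF, kDF)`. -/
abbrev QP (kE kF kDF : ℕ) (γ : Coefs) (L YE YF YDF : ℤ) (k0 k1 k2 k3 : PC5) : Prop :=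
  cntE k0 k1 k2 k3 ≤ kE → cntF k0 k1 k2 k3 ≤ kF → cntDF k0 k1 k2 k3 ≤ kDF →
    -GP5 γ k0 k1 k2 k3 + YE * (if cntE k0 k1 k2 k3 = kE then 1 else 0) + YF * (if cntF k0 k1 k2 k3 = kF then 1 else 0)
      + YDF * (if cntDF k0 k1 k2 k3 = kDF then 1 else 0) ≤ L
/-- N-side predicate of branch `(kE, kF, kDF)`. -/
abbrev QN (kE kF kDF : ℕ) (γ : Coefs) (L : ℤ) (k0 k1 k2 k3 : NC5) : Prop :=
  cntX11 k0 k1 k2 k3 ≤ kE → cntNB k0 k1 k2 k3 ≤ kF → cntQNB k0 k1 k2 k3 ≤ kDF → GN5 γ k0 k1 k2 k3 ≤ L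
/-- P-side predicate of the `μ`-branch. -/
abbrev QP0 (γ : Coefs) (L : ℤ) (k0 k1 k2 k3 : PC5) : Prop :=
  cntDF k0 k1 k2 k3 = 0 → GP5 γ k0 k1 k2 k3 ≤ 0 ∧ L ^ 2 * (k0.bv * k1.bv * k2.bv * k3.bv) ≤ GP5 γ k0 k1 k2 k3 ^ 2
/-- N-side predicate of the `μ`-branch. -/
abbrev QN0 (γ : Coefs) (L : ℤ) (k0 k1 k2 k3 : NC5) : Prop :=
  cntQNB k0 k1 k2 k3 = 0 → L * (k0.sv * k1.sv * k2.sv * k3.sv) ≤ GN5 γ k0 k1 k2 k3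

/-- sorted-tuple `Bool` check, P side -/
def chkP5 (kE kF kDF : ℕ) (γ : Coefs) (L YE YF YDF : ℤ) : Bool :=
  allPC5 fun k0 => allPC5 fun k1 => allPC5 fun k2 => allPC5 fun k3 =>
    decide (k0.idx ≤ k1.idx → k1.idx ≤ k2.idx → k2.idx ≤ k3.idx → QP kE kF kDF γ L YE YF YDF k0 k1 k2 k3)
/-- sorted-tuple `Bool` check, N side -/
def chkN5 (kE kF kDF : ℕ) (γ : Coefs) (L : ℤ) : Bool :=
  allNC5 fun k0 => allNC5 fun k1 => allNC5 fun k2 => allNC5 fun k3 =>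
    decide (k0.idx ≤ k1.idx → k1.idx ≤ k2.idx → k2.idx ≤ k3.idx → QN kE kF kDF γ L k0 k1 k2 k3)
/-- sorted-tuple `Bool` check, `μ`-branch P side -/
def chkP50 (γ : Coefs) (L : ℤ) : Bool :=
  allPC5 fun k0 => allPC5 fun k1 => allPC5 fun k2 => allPC5 fun k3 =>
    decide (k0.idx ≤ k1.idx → k1.idx ≤ k2.idx → k2.idx ≤ k3.idx → QP0 γ L k0 k1 k2 k3)
/-- sorted-tuple `Bool` check, `μ`-branch N side -/
def chkN50 (γ : Coefs) (L : ℤ) : Bool :=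
  allNC5 fun k0 => allNC5 fun k1 => allNC5 fun k2 => allNC5 fun k3 =>
    decide (k0.idx ≤ k1.idx → k1.idx ≤ k2.idx → k2.idx ≤ k3.idx → QN0 γ L k0 k1 k2 k3)

/-! #### slot symmetry of everything that enters the predicates -/

theorem GP5_swap01 (γ : Coefs) (k0 k1 k2 k3 : PC5) : GP5 γ k1 k0 k2 k3 = GP5 γ k0 k1 k2 k3 := by
  unfold GP5 Gpoly oHH oP oHHH oPH oHHHH oPHH oPP oPHHH oPPH oPPHH oPPP; ring
theorem GP5_swap12 (γ : Coefs) (k0 k1 k2 k3 : PC5) : GP5 γ k0 k2 k1 k3 = GP5 γ k0 k1 k2 k3 := by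
  unfold GP5 Gpoly oHH oP oHHH oPH oHHHH oPHH oPP oPHHH oPPH oPPHH oPPP; ring
theorem GP5_swap23 (γ : Coefs) (k0 k1 k2 k3 : PC5) : GP5 γ k0 k1 k3 k2 = GP5 γ k0 k1 k2 k3 := by
  unfold GP5 Gpoly oHH oP oHHH oPH oHHHH oPHH oPP oPHHH oPPH oPPHH oPPP; ring
theorem GN5_swap01 (γ : Coefs) (k0 k1 k2 k3 : NC5) : GN5 γ k1 k0 k2 k3 = GN5 γ k0 k1 k2 k3 := by
  unfold GN5 Gpoly oHH oP oHHH oPH oHHHH oPHH oPP oPHHH oPPH oPPHH oPPP; ring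
theorem GN5_swap12 (γ : Coefs) (k0 k1 k2 k3 : NC5) : GN5 γ k0 k2 k1 k3 = GN5 γ k0 k1 k2 k3 := by
  unfold GN5 Gpoly oHH oP oHHH oPH oHHHH oPHH oPP oPHHH oPPH oPPHH oPPP; ring
theorem GN5_swap23 (γ : Coefs) (k0 k1 k2 k3 : NC5) : GN5 γ k0 k1 k3 k2 = GN5 γ k0 k1 k2 k3 := by
  unfold GN5 Gpoly oHH oP oHHH oPH oHHHH oPHH oPP oPHHH oPPH oPPHH oPPP; ring

theorem QP_swap01 (kE kF kDF : ℕ) (γ : Coefs) (L YE YF YDF : ℤ) (x y z w : PC5)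
    (h : QP kE kF kDF γ L YE YF YDF x y z w) : QP kE kF kDF γ L YE YF YDF y x z w := by
  unfold QP at *
  have e1 : cntE y x z w = cntE x y z w := by unfold cntE; omega
  have e2 : cntF y x z w = cntF x y z w := by unfold cntF; omega
  have e3 : cntDF y x z w = cntDF x y z w := by unfold cntDF; omega
  rw [e1, e2, e3, GP5_swap01]; exact h
theorem QP_swap12 (kE kF kDF : ℕ) (γ : Coefs) (L YE YF YDF : ℤ) (x y z w : PC5)
    (h : QP kE kF kDF γ L YE YF YDF x y z w) : QP kE kF kDF γ L YE YF YDF x z y w := by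
  unfold QP at *
  have e1 : cntE x z y w = cntE x y z w := by unfold cntE; omega
  have e2 : cntF x z y w = cntF x y z w := by unfold cntF; omega
  have e3 : cntDF x z y w = cntDF x y z w := by unfold cntDF; omega
  rw [e1, e2, e3, GP5_swap12]; exact h
theorem QP_swap23 (kE kF kDF : ℕ) (γ : Coefs) (L YE YF YDF : ℤ) (x y z w : PC5)
    (h : QP kE kF kDF γ L YE YF YDF x y z w) : QP kE kF kDF γ L YE YF YDF x y w z := by
  unfold QP at *
  have e1 : cntE x y w z = cntE x y z w := by unfold cntE; omega
  have e2 : cntF x y w z = cntF x y z w := by unfold cntF; omega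
  have e3 : cntDF x y w z = cntDF x y z w := by unfold cntDF; omega
  rw [e1, e2, e3, GP5_swap23]; exact h

theorem QN_swap01 (kE kF kDF : ℕ) (γ : Coefs) (L : ℤ) (x y z w : NC5)
    (h : QN kE kF kDF γ L x y z w) : QN kE kF kDF γ L y x z w := by
  unfold QN at *
  have e1 : cntX11 y x z w = cntX11 x y z w := by unfold cntX11; omega
  have e2 : cntNB y x z w = cntNB x y z w := by unfold cntNB; omega
  have e3 : cntQNB y x z w = cntQNB x y z w := by unfold cntQNB; omega
  rw [e1, e2, e3, GN5_swap01]; exact h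
theorem QN_swap12 (kE kF kDF : ℕ) (γ : Coefs) (L : ℤ) (x y z w : NC5)
    (h : QN kE kF kDF γ L x y z w) : QN kE kF kDF γ L x z y w := by
  unfold QN at *
  have e1 : cntX11 x z y w = cntX11 x y z w := by unfold cntX11; omega
  have e2 : cntNB x z y w = cntNB x y z w := by unfold cntNB; omega
  have e3 : cntQNB x z y w = cntQNB x y z w := by unfold cntQNB; omega
  rw [e1, e2, e3, GN5_swap12]; exact h
theorem QN_swap23 (kE kF kDF : ℕ) (γ : Coefs) (L : ℤ) (x y z w : NC5)
    (h : QN kE kF kDF γ L x y z w) : QN kE kF kDF γ L x y w z := by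
  unfold QN at *
  have e1 : cntX11 x y w z = cntX11 x y z w := by unfold cntX11; omega
  have e2 : cntNB x y w z = cntNB x y z w := by unfold cntNB; omega
  have e3 : cntQNB x y w z = cntQNB x y z w := by unfold cntQNB; omega
  rw [e1, e2, e3, GN5_swap23]; exact h

theorem QP0_swap01 (γ : Coefs) (L : ℤ) (x y z w : PC5) (h : QP0 γ L x y z w) : QP0 γ L y x z w := by
  unfold QP0 at *
  have e3 : cntDF y x z w = cntDF x y z w := by unfold cntDF; omega
  have e4 : y.bv * x.bv * z.bv * w.bv = x.bv * y.bv * z.bv * w.bv := by ring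
  rw [e3, e4, GP5_swap01]; exact h
theorem QP0_swap12 (γ : Coefs) (L : ℤ) (x y z w : PC5) (h : QP0 γ L x y z w) : QP0 γ L x z y w := by
  unfold QP0 at *
  have e3 : cntDF x z y w = cntDF x y z w := by unfold cntDF; omega
  have e4 : x.bv * z.bv * y.bv * w.bv = x.bv * y.bv * z.bv * w.bv := by ring
  rw [e3, e4, GP5_swap12]; exact h
theorem QP0_swap23 (γ : Coefs) (L : ℤ) (x y z w : PC5) (h : QP0 γ L x y z w) : QP0 γ L x y w z := by
  unfold QP0 at *
  have e3 : cntDF x y w z = cntDF x y z w := by unfold cntDF; omega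
  have e4 : x.bv * y.bv * w.bv * z.bv = x.bv * y.bv * z.bv * w.bv := by ring
  rw [e3, e4, GP5_swap23]; exact h

theorem QN0_swap01 (γ : Coefs) (L : ℤ) (x y z w : NC5) (h : QN0 γ L x y z w) : QN0 γ L y x z w := by
  unfold QN0 at *
  have e3 : cntQNB y x z w = cntQNB x y z w := by unfold cntQNB; omega
  have e4 : y.sv * x.sv * z.sv * w.sv = x.sv * y.sv * z.sv * w.sv := by ring
  rw [e3, e4, GN5_swap01]; exact h
theorem QN0_swap12 (γ : Coefs) (L : ℤ) (x y z w : NC5) (h : QN0 γ L x y z w) : QN0 γ L x z y w := by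
  unfold QN0 at *
  have e3 : cntQNB x z y w = cntQNB x y z w := by unfold cntQNB; omega
  have e4 : x.sv * z.sv * y.sv * w.sv = x.sv * y.sv * z.sv * w.sv := by ring
  rw [e3, e4, GN5_swap12]; exact h
theorem QN0_swap23 (γ : Coefs) (L : ℤ) (x y z w : NC5) (h : QN0 γ L x y z w) : QN0 γ L x y w z := by
  unfold QN0 at *
  have e3 : cntQNB x y w z = cntQNB x y z w := by unfold cntQNB; omega
  have e4 : x.sv * y.sv * w.sv * z.sv = x.sv * y.sv * z.sv * w.sv := by ring
  rw [e3, e4, GN5_swap23]; exact h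

theorem chkP5_spec (kE kF kDF : ℕ) (γ : Coefs) (L YE YF YDF : ℤ) (h : chkP5 kE kF kDF γ L YE YF YDF = true)
    (k0 k1 k2 k3 : PC5) (hE : cntE k0 k1 k2 k3 ≤ kE) (hF : cntF k0 k1 k2 k3 ≤ kF) (hDF : cntDF k0 k1 k2 k3 ≤ kDF) :
    -GP5 γ k0 k1 k2 k3 + YE * (if cntE k0 k1 k2 k3 = kE then 1 else 0) + YF * (if cntF k0 k1 k2 k3 = kF then 1 else 0)
      + YDF * (if cntDF k0 k1 k2 k3 = kDF then 1 else 0) ≤ L :=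
  forall_of_sorted4 PC5.idx (QP kE kF kDF γ L YE YF YDF) (QP_swap01 kE kF kDF γ L YE YF YDF) (QP_swap12 kE kF kDF γ L YE YF YDF)
    (QP_swap23 kE kF kDF γ L YE YF YDF)
    (fun a b c d h1 h2 h3 => of_decide_eq_true (allPC5_spec _ (allPC5_spec _ (allPC5_spec _ (allPC5_spec _ h a) b) c) d) h1 h2 h3)
    k0 k1 k2 k3 hE hF hDF

theorem chkN5_spec (kE kF kDF : ℕ) (γ : Coefs) (L : ℤ) (h : chkN5 kE kF kDF γ L = true) (k0 k1 k2 k3 : NC5)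
    (hE : cntX11 k0 k1 k2 k3 ≤ kE) (hF : cntNB k0 k1 k2 k3 ≤ kF) (hDF : cntQNB k0 k1 k2 k3 ≤ kDF) : GN5 γ k0 k1 k2 k3 ≤ L :=
  forall_of_sorted4 NC5.idx (QN kE kF kDF γ L) (QN_swap01 kE kF kDF γ L) (QN_swap12 kE kF kDF γ L) (QN_swap23 kE kF kDF γ L)
    (fun a b c d h1 h2 h3 => of_decide_eq_true (allNC5_spec _ (allNC5_spec _ (allNC5_spec _ (allNC5_spec _ h a) b) c) d) h1 h2 h3)
    k0 k1 k2 k3 hE hF hDF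

theorem chkP50_spec (γ : Coefs) (L : ℤ) (h : chkP50 γ L = true) (k0 k1 k2 k3 : PC5) (hk : cntDF k0 k1 k2 k3 = 0) :
    GP5 γ k0 k1 k2 k3 ≤ 0 ∧ L ^ 2 * (k0.bv * k1.bv * k2.bv * k3.bv) ≤ GP5 γ k0 k1 k2 k3 ^ 2 :=
  forall_of_sorted4 PC5.idx (QP0 γ L) (QP0_swap01 γ L) (QP0_swap12 γ L) (QP0_swap23 γ L)
    (fun a b c d h1 h2 h3 => of_decide_eq_true (allPC5_spec _ (allPC5_spec _ (allPC5_spec _ (allPC5_spec _ h a) b) c) d) h1 h2 h3)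
    k0 k1 k2 k3 hk

theorem chkN50_spec (γ : Coefs) (L : ℤ) (h : chkN50 γ L = true) (k0 k1 k2 k3 : NC5) (hk : cntQNB k0 k1 k2 k3 = 0) :
    L * (k0.sv * k1.sv * k2.sv * k3.sv) ≤ GN5 γ k0 k1 k2 k3 :=
  forall_of_sorted4 NC5.idx (QN0 γ L) (QN0_swap01 γ L) (QN0_swap12 γ L) (QN0_swap23 γ L)
    (fun a b c d h1 h2 h3 => of_decide_eq_true (allNC5_spec _ (allNC5_spec _ (allNC5_spec _ (allNC5_spec _ h a) b) c) d) h1 h2 h3)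
    k0 k1 k2 k3 hk

/-! ### The certificates (own exact LP `work/ring5/fam5.py` + `cert5.py`, gs-eng-2 g59): 13 `(kF,kDF)` branches with `E` free (`kE = 4`, `YE = 0`),
five `(kE, 3, 4)` branches, and the `μ`-branch `(kF,kDF) = (0,0)`.  Weakest: `(1,3,4)` with `ΣY∕L = 1110065∕5576 ≈ 199.079 > 199`. -/

/-- branch `(kE free, kF = 0, kDF = 1)`: LP value INFEASIBLE -/
def γx01 : Coefs := ⟨249704, 249704, -41209, -20825, 4676, -115⟩
theorem chkN_x01 : chkN5 4 0 1 γx01 0 = true := by decide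
theorem chkP_x01 : chkP5 4 0 1 γx01 0 0 0 234240 = true := by decide
/-- branch `(kE free, kF = 0, kDF = 2)`: LP value 1218 -/
def γx02 : Coefs := ⟨1199012, -336720, 23611, 11823, -1656, 29⟩
theorem chkN_x02 : chkN5 4 0 2 γx02 24 = true := by decide
theorem chkP_x02 : chkP5 4 0 2 γx02 24 0 0 29232 = true := by decide
/-- branch `(kE free, kF = 0, kDF = 3)`: LP value 24290/27 -/
def γx03 : Coefs := ⟨286622032, -83078892, 6019758, 3012079, -436482, 7912⟩
theorem chkN_x03 : chkN5 4 0 3 γx03 9720 = true := by decide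
theorem chkP_x03 : chkP5 4 0 3 γx03 9720 0 0 8744400 = true := by decide
/-- branch `(kE free, kF = 0, kDF = 4)`: LP value 162785/81 -/
def γx04 : Coefs := ⟨171420080, -49926672, 3634632, 1819076, -264816, 4823⟩
theorem chkN_x04 : chkN5 4 0 4 γx04 7776 = true := by decide
theorem chkP_x04 : chkP5 4 0 4 γx04 7776 0 0 15627360 = true := by decide
/-- branch `(kE free, kF = 1, kDF = 1)`: LP value INFEASIBLE -/
def γx11 : Coefs := ⟨729904, 729904, -120932, -61348, 13804, -341⟩
theorem chkN_x11 : chkN5 4 1 1 γx11 0 = true := by decide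
theorem chkP_x11 : chkP5 4 1 1 γx11 0 0 200112 587352 = true := by decide
/-- branch `(kE free, kF = 1, kDF = 2)`: LP value 84299/192 -/
def γx12 : Coefs := ⟨48259760, -13639424, 962784, 482008, -67984, 1199⟩
theorem chkN_x12 : chkN5 4 1 2 γx12 3072 = true := by decide
theorem chkP_x12 : chkP5 4 1 2 γx12 3072 0 352240 996544 = true := by decide
/-- branch `(kE free, kF = 1, kDF = 3)`: LP value 45190681/139968 -/
def γx13 : Coefs := ⟨16804966168, -4876912340, 353797684, 176986430, -25677995, 465910⟩
theorem chkN_x13 : chkN5 4 1 3 γx13 1679616 = true := by decide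
theorem chkP_x13 : chkP5 4 1 3 γx13 1679616 0 67354668 474933504 = true := by decide
/-- branch `(kE free, kF = 1, kDF = 4)`: LP value 7494653/13230 -/
def γx14 : Coefs := ⟨3872750384, -1125093896, 81689408, 40791852, -5921774, 107287⟩
theorem chkN_x14 : chkN5 4 1 4 γx14 635040 = true := by decide
theorem chkP_x14 : chkP5 4 1 4 γx14 635040 0 8929488 350813856 = true := by decide
/-- branch `(kE free, kF = 2, kDF = 2)`: LP value 16957/48 -/
def γx22 : Coefs := ⟨3309736, -927004, 64782, 32468, -4529, 79⟩
theorem chkN_x22 : chkN5 4 2 2 γx22 384 = true := by decide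
theorem chkP_x22 : chkP5 4 2 2 γx22 384 0 135656 0 = true := by decide
/-- branch `(kE free, kF = 2, kDF = 3)`: LP value 844861/3072 -/
def γx23 : Coefs := ⟨26850064, -6478816, 371088, 190472, -20216, 241⟩
theorem chkN_x23 : chkN5 4 2 3 γx23 24576 = true := by decide
theorem chkP_x23 : chkP5 4 2 3 γx23 24576 0 2634344 4124544 = true := by decide
/-- branch `(kE free, kF = 2, kDF = 4)`: LP value 42226579/175122 -/
def γx24 : Coefs := ⟨6764469776, -1965997532, 142798412, 71259796, -10348283, 187413⟩
theorem chkN_x24 : chkN5 4 2 4 γx24 2801952 = true := by decide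
theorem chkP_x24 : chkP5 4 2 4 γx24 2801952 0 89127952 586497312 = true := by decide
/-- branch `(kE free, kF = 3, kDF = 3)`: LP value 4269983/16758 -/
def γx33 : Coefs := ⟨6707055176, -1954557568, 142383400, 71246998, -10379930, 189183⟩
theorem chkN_x33 : chkN5 4 3 3 γx33 1608768 = true := by decide
theorem chkP_x33 : chkP5 4 3 3 γx33 1608768 0 409918368 0 = true := by decide
/-- branch `(kE free, kF = 4, kDF = 4)`: LP value 7854988/31185 -/
def γx44 : Coefs := ⟨2501736664, -733878992, 53803680, 26914574, -3945790, 72345⟩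
theorem chkN_x44 : chkN5 4 4 4 γx44 2993760 = true := by decide
theorem chkP_x44 : chkP5 4 4 4 γx44 2993760 0 754078848 0 = true := by decide
/-- branch `(kE = 0, kF = 3, kDF = 4)`: LP value 1836897/8912 -/
def γ034 : Coefs := ⟨206148980, -60671424, 4463829, 2234508, -328827, 6057⟩
theorem chkN_034 : chkN5 0 3 4 γ034 106944 = true := by decide
theorem chkP_034 : chkP5 0 3 4 γ034 106944 0 8689356 13353408 = true := by decide
/-- branch `(kE = 1, kF = 3, kDF = 4)`: LP value 1110065/5576 -/
def γ134 : Coefs := ⟨228844760, -67021200, 4906192, 2452554, -359042, 6569⟩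
theorem chkN_134 : chkN5 1 3 4 γ134 133824 = true := by decide
theorem chkP_134 : chkP5 1 3 4 γ134 133824 3312 10347240 16291008 = true := by decide
/-- branch `(kE = 2, kF = 3, kDF = 4)`: LP value 15320261/76376 -/
def γ234 : Coefs := ⟨3040886040, -889991760, 65106360, 32547394, -4761458, 87057⟩
theorem chkN_234 : chkN5 2 3 4 γ234 1833024 = true := by decide
theorem chkP_234 : chkP5 2 3 4 γ234 1833024 7353360 140217384 220115520 = true := by decide
/-- branch `(kE = 3, kF = 3, kDF = 4)`: LP value 1363157/6060 -/
def γ334 : Coefs := ⟨230741000, -67353216, 4913610, 2454016, -357974, 6519⟩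
theorem chkN_334 : chkN5 3 3 4 γ334 145440 = true := by decide
theorem chkP_334 : chkP5 3 3 4 γ334 145440 4363200 10922520 17430048 = true := by decide
/-- branch `(kE = 4, kF = 3, kDF = 4)`: LP value 157105271/415503 -/
def γ434 : Coefs := ⟨7606506482, -2215577688, 161272133, 80459175, -11709160, 212470⟩
theorem chkN_434 : chkN5 4 3 4 γ434 4986036 = true := by decide
theorem chkP_434 : chkP5 4 3 4 γ434 4986036 930783528 363329016 591150708 = true := by decide
/-- μ-branch `(kF, kDF) = (0, 0)` (no `D`, no `F`; hence no `Q`, no `NB`): e-free + `|∏β̄|` domination -/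
def γmu : Coefs := ⟨-3011568, 11731148, -1811856, -3011568, 525903, -17152⟩
theorem chkN_mu : chkN50 γmu 3011568 = true := by decide
theorem chkP_mu : chkP50 γmu 3011568 = true := by decide


/-! ## §4 Letter shapes: P-letters (off-axis, co-level ≤ 5), N-letters (co-level ≤ 3), the three COVER LEMMAS -/

/-- a `D` letter `(10; ±2, ±2)` -/
def isD (ℓ : Letter) : Bool := decide (ℓ.a = 10) && decide (|ℓ.x| = 2) && decide (|ℓ.y| = 2)
/-- an `E` letter `(9; ±4, ±1)` or `(9; ±1, ±4)` -/
def isE (ℓ : Letter) : Bool :=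
  decide (ℓ.a = 9) && ((decide (|ℓ.x| = 4) && decide (|ℓ.y| = 1)) || (decide (|ℓ.x| = 1) && decide (|ℓ.y| = 4)))
/-- an `F` letter `(9; ±3, ±2)` or `(9; ±2, ±3)` -/
def isF (ℓ : Letter) : Bool :=
  decide (ℓ.a = 9) && ((decide (|ℓ.x| = 3) && decide (|ℓ.y| = 2)) || (decide (|ℓ.x| = 2) && decide (|ℓ.y| = 3)))
/-- a `Q` letter `(12; ±1, ±1)` -/
def isQ (ℓ : Letter) : Bool := decide (ℓ.a = 12) && decide (|ℓ.x| = 1) && decide (|ℓ.y| = 1)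
/-- an `X11` letter `(11; ±3, 0)` or `(11; 0, ±3)` -/
def isX11 (ℓ : Letter) : Bool :=
  decide (ℓ.a = 11) && ((decide (|ℓ.x| = 3) && decide (|ℓ.y| = 0)) || (decide (|ℓ.x| = 0) && decide (|ℓ.y| = 3)))
/-- an `NB` letter `(11; ±2, ±1)` or `(11; ±1, ±2)` -/
def isNB (ℓ : Letter) : Bool :=
  decide (ℓ.a = 11) && ((decide (|ℓ.x| = 2) && decide (|ℓ.y| = 1)) || (decide (|ℓ.x| = 1) && decide (|ℓ.y| = 2)))

/-- admissible P-letter at ring 5 -/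
def PAdm (ℓ : Letter) : Prop := ℓ.OnAlphabet 14 ∧ ℓ.colevel ≤ 5 ∧ ℓ.x ≠ 0 ∧ ℓ.y ≠ 0
/-- admissible N-letter at ring 5 -/
def NAdm (ℓ : Letter) : Prop := ℓ.OnAlphabet 14 ∧ ℓ.colevel ≤ 3

/-- `ℓ` has the class data of `K`. -/
def PRep (ℓ : Letter) (K : PC5) : Prop :=
  ℓ.a = K.av ∧ ℓ.selfInt = K.nv ∧ ℓ.bnorm = K.bv ∧ isD ℓ = K.isD ∧ isE ℓ = K.isE ∧ isF ℓ = K.isF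
/-- `ℓ` has the class data of `K` (N side). -/
def NRep (ℓ : Letter) (K : NC5) : Prop :=
  ℓ.a = K.av ∧ ℓ.selfInt = K.nv ∧ isQ ℓ = K.isQ ∧ isX11 ℓ = K.isX11 ∧ isNB ℓ = K.isNB ∧
    (K.isQ = false → K.isNB = false → ℓ.bnorm = K.sv ^ 2)

theorem exists_PRep {ℓ : Letter} (h : PAdm ℓ) : ∃ K : PC5, PRep ℓ K := by
  obtain ⟨⟨hh, _⟩, hc, hx, hy⟩ := h
  unfold Letter.height at hh
  unfold Letter.colevel at hc
  have hx1 : 1 ≤ |ℓ.x| := Int.one_le_abs hx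
  have hy1 : 1 ≤ |ℓ.y| := Int.one_le_abs hy
  have hx2 : ℓ.x ^ 2 = |ℓ.x| ^ 2 := (sq_abs ℓ.x).symm
  have hy2 : ℓ.y ^ 2 = |ℓ.y| ^ 2 := (sq_abs ℓ.y).symm
  unfold PRep isD isE isF Letter.selfInt Letter.bnorm
  rw [hx2, hy2]
  rcases (show (|ℓ.x| = 1 ∧ |ℓ.y| = 1) ∨ (|ℓ.x| = 2 ∧ |ℓ.y| = 1) ∨ (|ℓ.x| = 1 ∧ |ℓ.y| = 2) ∨ (|ℓ.x| = 3 ∧ |ℓ.y| = 1)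
      ∨ (|ℓ.x| = 1 ∧ |ℓ.y| = 3) ∨ (|ℓ.x| = 2 ∧ |ℓ.y| = 2) ∨ (|ℓ.x| = 4 ∧ |ℓ.y| = 1) ∨ (|ℓ.x| = 1 ∧ |ℓ.y| = 4)
      ∨ (|ℓ.x| = 3 ∧ |ℓ.y| = 2) ∨ (|ℓ.x| = 2 ∧ |ℓ.y| = 3) by omega) with
    ⟨hu, hv⟩ | ⟨hu, hv⟩ | ⟨hu, hv⟩ | ⟨hu, hv⟩ | ⟨hu, hv⟩ | ⟨hu, hv⟩ | ⟨hu, hv⟩ | ⟨hu, hv⟩ | ⟨hu, hv⟩ | ⟨hu, hv⟩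
  · exact ⟨PC5.A, by rw [hu, hv, show ℓ.a = 12 by omega]; decide⟩
  · exact ⟨PC5.B, by rw [hu, hv, show ℓ.a = 11 by omega]; decide⟩
  · exact ⟨PC5.B, by rw [hu, hv, show ℓ.a = 11 by omega]; decide⟩
  · exact ⟨PC5.C, by rw [hu, hv, show ℓ.a = 10 by omega]; decide⟩
  · exact ⟨PC5.C, by rw [hu, hv, show ℓ.a = 10 by omega]; decide⟩
  · exact ⟨PC5.D, by rw [hu, hv, show ℓ.a = 10 by omega]; decide⟩
  · exact ⟨PC5.E, by rw [hu, hv, show ℓ.a = 9 by omega]; decide⟩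
  · exact ⟨PC5.E, by rw [hu, hv, show ℓ.a = 9 by omega]; decide⟩
  · exact ⟨PC5.F, by rw [hu, hv, show ℓ.a = 9 by omega]; decide⟩
  · exact ⟨PC5.F, by rw [hu, hv, show ℓ.a = 9 by omega]; decide⟩

theorem exists_NRep {ℓ : Letter} (h : NAdm ℓ) : ∃ K : NC5, NRep ℓ K := by
  obtain ⟨⟨hh, _⟩, hc⟩ := h
  unfold Letter.height at hh
  unfold Letter.colevel at hc
  have hx0 := abs_nonneg ℓ.x
  have hy0 := abs_nonneg ℓ.y
  have hx2 : ℓ.x ^ 2 = |ℓ.x| ^ 2 := (sq_abs ℓ.x).symm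
  have hy2 : ℓ.y ^ 2 = |ℓ.y| ^ 2 := (sq_abs ℓ.y).symm
  unfold NRep isQ isX11 isNB Letter.selfInt Letter.bnorm
  rw [hx2, hy2]
  rcases (show (|ℓ.x| = 0 ∧ |ℓ.y| = 0) ∨ (|ℓ.x| = 1 ∧ |ℓ.y| = 0) ∨ (|ℓ.x| = 0 ∧ |ℓ.y| = 1) ∨ (|ℓ.x| = 2 ∧ |ℓ.y| = 0)
      ∨ (|ℓ.x| = 0 ∧ |ℓ.y| = 2) ∨ (|ℓ.x| = 1 ∧ |ℓ.y| = 1) ∨ (|ℓ.x| = 3 ∧ |ℓ.y| = 0) ∨ (|ℓ.x| = 0 ∧ |ℓ.y| = 3)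
      ∨ (|ℓ.x| = 2 ∧ |ℓ.y| = 1) ∨ (|ℓ.x| = 1 ∧ |ℓ.y| = 2) by omega) with
    ⟨hu, hv⟩ | ⟨hu, hv⟩ | ⟨hu, hv⟩ | ⟨hu, hv⟩ | ⟨hu, hv⟩ | ⟨hu, hv⟩ | ⟨hu, hv⟩ | ⟨hu, hv⟩ | ⟨hu, hv⟩ | ⟨hu, hv⟩
  · exact ⟨NC5.H, by rw [hu, hv, show ℓ.a = 14 by omega]; decide⟩
  · exact ⟨NC5.X13, by rw [hu, hv, show ℓ.a = 13 by omega]; decide⟩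
  · exact ⟨NC5.X13, by rw [hu, hv, show ℓ.a = 13 by omega]; decide⟩
  · exact ⟨NC5.X12, by rw [hu, hv, show ℓ.a = 12 by omega]; decide⟩
  · exact ⟨NC5.X12, by rw [hu, hv, show ℓ.a = 12 by omega]; decide⟩
  · exact ⟨NC5.Q, by rw [hu, hv, show ℓ.a = 12 by omega]; decide⟩
  · exact ⟨NC5.X11, by rw [hu, hv, show ℓ.a = 11 by omega]; decide⟩
  · exact ⟨NC5.X11, by rw [hu, hv, show ℓ.a = 11 by omega]; decide⟩
  · exact ⟨NC5.NB, by rw [hu, hv, show ℓ.a = 11 by omega]; decide⟩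
  · exact ⟨NC5.NB, by rw [hu, hv, show ℓ.a = 11 by omega]; decide⟩

/-- The ten admissible P shapes `(|x|, |y|)` (co-level 2..5, off-axis) — shared case split. -/
theorem P_shapes {ℓ : Letter} (h : PAdm ℓ) :
    ℓ.a + |ℓ.x| + |ℓ.y| = 14 ∧ ((|ℓ.x| = 1 ∧ |ℓ.y| = 1) ∨ (|ℓ.x| = 2 ∧ |ℓ.y| = 1) ∨ (|ℓ.x| = 1 ∧ |ℓ.y| = 2)
      ∨ (|ℓ.x| = 3 ∧ |ℓ.y| = 1) ∨ (|ℓ.x| = 1 ∧ |ℓ.y| = 3) ∨ (|ℓ.x| = 2 ∧ |ℓ.y| = 2) ∨ (|ℓ.x| = 4 ∧ |ℓ.y| = 1)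
      ∨ (|ℓ.x| = 1 ∧ |ℓ.y| = 4) ∨ (|ℓ.x| = 3 ∧ |ℓ.y| = 2) ∨ (|ℓ.x| = 2 ∧ |ℓ.y| = 3)) := by
  obtain ⟨⟨hh, _⟩, hc, hx, hy⟩ := h
  unfold Letter.height at hh
  unfold Letter.colevel at hc
  have hx1 : 1 ≤ |ℓ.x| := Int.one_le_abs hx
  have hy1 : 1 ≤ |ℓ.y| := Int.one_le_abs hy
  exact ⟨hh, by omega⟩

/-- **COVER LEMMA Q.** An admissible P-letter amply below a `Q` letter is a `D` or an `F` letter. -/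
theorem isDF_of_ample_isQ {ℓ ℓ' : Letter} (hP : PAdm ℓ) (hQ : isQ ℓ' = true) (hA : AmpleAbove ℓ ℓ') :
    (isD ℓ || isF ℓ) = true := by
  obtain ⟨hh, hshape⟩ := P_shapes hP
  simp only [isQ, Bool.and_eq_true, decide_eq_true_eq] at hQ
  obtain ⟨⟨ha', hx'⟩, hy'⟩ := hQ
  obtain ⟨hlt, hsq⟩ := hA
  have ex := sq_abs_sub_abs_le ℓ.x ℓ'.x
  have ey := sq_abs_sub_abs_le ℓ.y ℓ'.y
  rw [hx'] at ex
  rw [hy'] at ey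
  rw [ha'] at hlt hsq
  have key : (|ℓ.x| - 1) ^ 2 + (|ℓ.y| - 1) ^ 2 < (12 - ℓ.a) ^ 2 := by linarith
  simp only [isD, isF, Bool.or_eq_true, Bool.and_eq_true, decide_eq_true_eq]
  rcases hshape with ⟨hu, hv⟩ | ⟨hu, hv⟩ | ⟨hu, hv⟩ | ⟨hu, hv⟩ | ⟨hu, hv⟩ | ⟨hu, hv⟩ | ⟨hu, hv⟩ | ⟨hu, hv⟩ | ⟨hu, hv⟩ | ⟨hu, hv⟩
  · exfalso; omega
  · exfalso; rw [hu, hv, show ℓ.a = 11 by omega] at key; norm_num at key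
  · exfalso; rw [hu, hv, show ℓ.a = 11 by omega] at key; norm_num at key
  · exfalso; rw [hu, hv, show ℓ.a = 10 by omega] at key; norm_num at key
  · exfalso; rw [hu, hv, show ℓ.a = 10 by omega] at key; norm_num at key
  · exact Or.inl ⟨⟨by omega, hu⟩, hv⟩
  · exfalso; rw [hu, hv, show ℓ.a = 9 by omega] at key; norm_num at key
  · exfalso; rw [hu, hv, show ℓ.a = 9 by omega] at key; norm_num at key
  · exact Or.inr ⟨by omega, Or.inl ⟨hu, hv⟩⟩
  · exact Or.inr ⟨by omega, Or.inr ⟨hu, hv⟩⟩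

/-- **COVER LEMMA NB.** An admissible P-letter amply below an `NB` letter `(11; ±2, ±1)~` is an `F` letter. -/
theorem isF_of_ample_isNB {ℓ ℓ' : Letter} (hP : PAdm ℓ) (hB : isNB ℓ' = true) (hA : AmpleAbove ℓ ℓ') :
    isF ℓ = true := by
  obtain ⟨hh, hshape⟩ := P_shapes hP
  simp only [isNB, Bool.and_eq_true, Bool.or_eq_true, decide_eq_true_eq] at hB
  obtain ⟨ha', hxy'⟩ := hB
  obtain ⟨hlt, hsq⟩ := hA
  have ex := sq_abs_sub_abs_le ℓ.x ℓ'.x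
  have ey := sq_abs_sub_abs_le ℓ.y ℓ'.y
  rw [ha'] at hlt hsq
  simp only [isF, Bool.or_eq_true, Bool.and_eq_true, decide_eq_true_eq]
  rcases hxy' with ⟨hx', hy'⟩ | ⟨hx', hy'⟩
  · rw [hx'] at ex
    rw [hy'] at ey
    have key : (|ℓ.x| - 2) ^ 2 + (|ℓ.y| - 1) ^ 2 < (11 - ℓ.a) ^ 2 := by linarith
    rcases hshape with ⟨hu, hv⟩ | ⟨hu, hv⟩ | ⟨hu, hv⟩ | ⟨hu, hv⟩ | ⟨hu, hv⟩ | ⟨hu, hv⟩ | ⟨hu, hv⟩ | ⟨hu, hv⟩ | ⟨hu, hv⟩ | ⟨hu, hv⟩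
    · exfalso; omega
    · exfalso; omega
    · exfalso; omega
    · exfalso; rw [hu, hv, show ℓ.a = 10 by omega] at key; norm_num at key
    · exfalso; rw [hu, hv, show ℓ.a = 10 by omega] at key; norm_num at key
    · exfalso; rw [hu, hv, show ℓ.a = 10 by omega] at key; norm_num at key
    · exfalso; rw [hu, hv, show ℓ.a = 9 by omega] at key; norm_num at key
    · exfalso; rw [hu, hv, show ℓ.a = 9 by omega] at key; norm_num at key
    · exact ⟨by omega, Or.inl ⟨hu, hv⟩⟩
    · exfalso; rw [hu, hv, show ℓ.a = 9 by omega] at key; norm_num at key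
  · rw [hx'] at ex
    rw [hy'] at ey
    have key : (|ℓ.x| - 1) ^ 2 + (|ℓ.y| - 2) ^ 2 < (11 - ℓ.a) ^ 2 := by linarith
    rcases hshape with ⟨hu, hv⟩ | ⟨hu, hv⟩ | ⟨hu, hv⟩ | ⟨hu, hv⟩ | ⟨hu, hv⟩ | ⟨hu, hv⟩ | ⟨hu, hv⟩ | ⟨hu, hv⟩ | ⟨hu, hv⟩ | ⟨hu, hv⟩
    · exfalso; omega
    · exfalso; omega
    · exfalso; omega
    · exfalso; rw [hu, hv, show ℓ.a = 10 by omega] at key; norm_num at key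
    · exfalso; rw [hu, hv, show ℓ.a = 10 by omega] at key; norm_num at key
    · exfalso; rw [hu, hv, show ℓ.a = 10 by omega] at key; norm_num at key
    · exfalso; rw [hu, hv, show ℓ.a = 9 by omega] at key; norm_num at key
    · exfalso; rw [hu, hv, show ℓ.a = 9 by omega] at key; norm_num at key
    · exfalso; rw [hu, hv, show ℓ.a = 9 by omega] at key; norm_num at key
    · exact ⟨by omega, Or.inr ⟨hu, hv⟩⟩

/-- **COVER LEMMA X11.** An admissible P-letter amply below an `X11` letter `(11; ±3, 0)~` is an `E` letter. -/
theorem isE_of_ample_isX11 {ℓ ℓ' : Letter} (hP : PAdm ℓ) (hX : isX11 ℓ' = true) (hA : AmpleAbove ℓ ℓ') :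
    isE ℓ = true := by
  obtain ⟨hh, hshape⟩ := P_shapes hP
  simp only [isX11, Bool.and_eq_true, Bool.or_eq_true, decide_eq_true_eq] at hX
  obtain ⟨ha', hxy'⟩ := hX
  obtain ⟨hlt, hsq⟩ := hA
  have ex := sq_abs_sub_abs_le ℓ.x ℓ'.x
  have ey := sq_abs_sub_abs_le ℓ.y ℓ'.y
  rw [ha'] at hlt hsq
  simp only [isE, Bool.or_eq_true, Bool.and_eq_true, decide_eq_true_eq]
  rcases hxy' with ⟨hx', hy'⟩ | ⟨hx', hy'⟩
  · rw [hx'] at ex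
    rw [hy'] at ey
    have key : (|ℓ.x| - 3) ^ 2 + (|ℓ.y| - 0) ^ 2 < (11 - ℓ.a) ^ 2 := by linarith
    rcases hshape with ⟨hu, hv⟩ | ⟨hu, hv⟩ | ⟨hu, hv⟩ | ⟨hu, hv⟩ | ⟨hu, hv⟩ | ⟨hu, hv⟩ | ⟨hu, hv⟩ | ⟨hu, hv⟩ | ⟨hu, hv⟩ | ⟨hu, hv⟩
    · exfalso; omega
    · exfalso; omega
    · exfalso; omega
    · exfalso; rw [hu, hv, show ℓ.a = 10 by omega] at key; norm_num at key
    · exfalso; rw [hu, hv, show ℓ.a = 10 by omega] at key; norm_num at key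
    · exfalso; rw [hu, hv, show ℓ.a = 10 by omega] at key; norm_num at key
    · exact ⟨by omega, Or.inl ⟨hu, hv⟩⟩
    · exfalso; rw [hu, hv, show ℓ.a = 9 by omega] at key; norm_num at key
    · exfalso; rw [hu, hv, show ℓ.a = 9 by omega] at key; norm_num at key
    · exfalso; rw [hu, hv, show ℓ.a = 9 by omega] at key; norm_num at key
  · rw [hx'] at ex
    rw [hy'] at ey
    have key : (|ℓ.x| - 0) ^ 2 + (|ℓ.y| - 3) ^ 2 < (11 - ℓ.a) ^ 2 := by linarith
    rcases hshape with ⟨hu, hv⟩ | ⟨hu, hv⟩ | ⟨hu, hv⟩ | ⟨hu, hv⟩ | ⟨hu, hv⟩ | ⟨hu, hv⟩ | ⟨hu, hv⟩ | ⟨hu, hv⟩ | ⟨hu, hv⟩ | ⟨hu, hv⟩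
    · exfalso; omega
    · exfalso; omega
    · exfalso; omega
    · exfalso; rw [hu, hv, show ℓ.a = 10 by omega] at key; norm_num at key
    · exfalso; rw [hu, hv, show ℓ.a = 10 by omega] at key; norm_num at key
    · exfalso; rw [hu, hv, show ℓ.a = 10 by omega] at key; norm_num at key
    · exfalso; rw [hu, hv, show ℓ.a = 9 by omega] at key; norm_num at key
    · exact ⟨by omega, Or.inr ⟨hu, hv⟩⟩
    · exfalso; rw [hu, hv, show ℓ.a = 9 by omega] at key; norm_num at key
    · exfalso; rw [hu, hv, show ℓ.a = 9 by omega] at key; norm_num at key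

/-- number of `E` slots of a cell -/
def ecount (x : Cell) : ℕ := (isE (x 0)).toNat + (isE (x 1)).toNat + (isE (x 2)).toNat + (isE (x 3)).toNat
/-- number of `F` slots -/
def fcount (x : Cell) : ℕ := (isF (x 0)).toNat + (isF (x 1)).toNat + (isF (x 2)).toNat + (isF (x 3)).toNat
/-- number of `D`-or-`F` slots -/
def dfcount (x : Cell) : ℕ :=
  (isD (x 0) || isF (x 0)).toNat + (isD (x 1) || isF (x 1)).toNat + (isD (x 2) || isF (x 2)).toNat + (isD (x 3) || isF (x 3)).toNat
/-- number of `X11` slots -/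
def x11count (y : Cell) : ℕ := (isX11 (y 0)).toNat + (isX11 (y 1)).toNat + (isX11 (y 2)).toNat + (isX11 (y 3)).toNat
/-- number of `NB` slots -/
def nbcount (y : Cell) : ℕ := (isNB (y 0)).toNat + (isNB (y 1)).toNat + (isNB (y 2)).toNat + (isNB (y 3)).toNat
/-- number of `Q`-or-`NB` slots -/
def qnbcount (y : Cell) : ℕ :=
  (isQ (y 0) || isNB (y 0)).toNat + (isQ (y 1) || isNB (y 1)).toNat + (isQ (y 2) || isNB (y 2)).toNat + (isQ (y 3) || isNB (y 3)).toNat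

theorem toNat_le_one' (b : Bool) : b.toNat ≤ 1 := by cases b <;> simp

theorem toNat_mono {a b : Bool} (h : a = true → b = true) : a.toNat ≤ b.toNat := by
  cases a <;> cases b <;> simp_all

theorem toNat_eq_zero' {b : Bool} (h : b.toNat = 0) : b = false := by
  cases b <;> simp_all

theorem ecount_le_four (x : Cell) : ecount x ≤ 4 := by
  unfold ecount
  have h0 := toNat_le_one' (isE (x 0)); have h1 := toNat_le_one' (isE (x 1))
  have h2 := toNat_le_one' (isE (x 2)); have h3 := toNat_le_one' (isE (x 3))
  omega

theorem fcount_le_four (x : Cell) : fcount x ≤ 4 := by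
  unfold fcount
  have h0 := toNat_le_one' (isF (x 0)); have h1 := toNat_le_one' (isF (x 1))
  have h2 := toNat_le_one' (isF (x 2)); have h3 := toNat_le_one' (isF (x 3))
  omega

theorem dfcount_le_four (x : Cell) : dfcount x ≤ 4 := by
  unfold dfcount
  have h0 := toNat_le_one' (isD (x 0) || isF (x 0)); have h1 := toNat_le_one' (isD (x 1) || isF (x 1))
  have h2 := toNat_le_one' (isD (x 2) || isF (x 2)); have h3 := toNat_le_one' (isD (x 3) || isF (x 3))
  omega

theorem fcount_le_dfcount (x : Cell) : fcount x ≤ dfcount x := by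
  unfold fcount dfcount
  have h : ∀ f, (isF (x f)).toNat ≤ (isD (x f) || isF (x f)).toNat := fun f => toNat_mono fun h => by simp [h]
  have h0 := h 0; have h1 := h 1; have h2 := h 2; have h3 := h 3
  omega

/-- Along a live arrow `x → y` (x admissible): `#X11(y) ≤ #E(x)`, `#NB(y) ≤ #F(x)`, `#(Q ∪ NB)(y) ≤ #(D ∪ F)(x)`. -/
theorem counts_le_of_live {x y : Cell} (hx : ∀ f, PAdm (x f)) (hl : Live x y) :
    x11count y ≤ ecount x ∧ nbcount y ≤ fcount x ∧ qnbcount y ≤ dfcount x := by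
  unfold x11count ecount nbcount fcount qnbcount dfcount
  have hE : ∀ f, (isX11 (y f)).toNat ≤ (isE (x f)).toNat :=
    fun f => toNat_mono fun hq => isE_of_ample_isX11 (hx f) hq (hl f)
  have hF : ∀ f, (isNB (y f)).toNat ≤ (isF (x f)).toNat :=
    fun f => toNat_mono fun hq => isF_of_ample_isNB (hx f) hq (hl f)
  have hDF : ∀ f, (isQ (y f) || isNB (y f)).toNat ≤ (isD (x f) || isF (x f)).toNat := fun f => toNat_mono fun hq => by
    simp only [Bool.or_eq_true] at hq
    rcases hq with h | h
    · exact isDF_of_ample_isQ (hx f) h (hl f)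
    · simp [isF_of_ample_isNB (hx f) h (hl f)]
  have e0 := hE 0; have e1 := hE 1; have e2 := hE 2; have e3 := hE 3
  have f0 := hF 0; have f1 := hF 1; have f2 := hF 2; have f3 := hF 3
  have d0 := hDF 0; have d1 := hDF 1; have d2 := hDF 2; have d3 := hDF 3
  exact ⟨by omega, by omega, by omega⟩

/-! ## §5 From the finite checks to bounds on admissible CELLS -/

theorem norm_cellCoef_eeee (c : Cell) :
    (cellCoef c Word.eeee).norm = (c 0).bnorm * (c 1).bnorm * (c 2).bnorm * (c 3).bnorm := by
  have hb : ∀ ℓ : Letter, (star ℓ.beta).norm = ℓ.bnorm := fun ℓ => by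
    rw [Zsqrtd.norm_conj, Zsqrtd.norm_def]; simp [Letter.beta, Letter.bnorm]; ring
  rw [cellCoef_eeee, Fin.prod_univ_four, Zsqrtd.norm_mul, Zsqrtd.norm_mul, Zsqrtd.norm_mul, hb, hb, hb, hb]

theorem re_sq_le_norm (z : GaussianInt) : z.re ^ 2 ≤ z.norm := by
  rw [Zsqrtd.norm_def]; nlinarith [sq_nonneg z.im]

theorem im_sq_le_norm (z : GaussianInt) : z.im ^ 2 ≤ z.norm := by
  rw [Zsqrtd.norm_def]; nlinarith [sq_nonneg z.re]

/-- Branch `(kE, kF, kDF)`, P side. -/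
theorem P_bound (kE kF kDF : ℕ) (γ : Coefs) (L YE YF YDF : ℤ) (hchk : chkP5 kE kF kDF γ L YE YF YDF = true) (x : Cell)
    (hx : ∀ f, PAdm (x f)) (hkE : ecount x ≤ kE) (hkF : fcount x ≤ kF) (hkDF : dfcount x ≤ kDF) :
    -Gcell γ x + YE * (if ecount x = kE then 1 else 0) + YF * (if fcount x = kF then 1 else 0)
      + YDF * (if dfcount x = kDF then 1 else 0) ≤ L := by
  have hK : ∀ f, ∃ K, PRep (x f) K := fun f => exists_PRep (hx f)
  choose K hK using hK
  have hG : Gcell γ x = GP5 γ (K 0) (K 1) (K 2) (K 3) := by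
    simp only [Gcell, GP5, (hK 0).1, (hK 0).2.1, (hK 1).1, (hK 1).2.1, (hK 2).1, (hK 2).2.1, (hK 3).1, (hK 3).2.1]
  have hcE : ecount x = cntE (K 0) (K 1) (K 2) (K 3) := by
    simp only [ecount, cntE, (hK 0).2.2.2.2.1, (hK 1).2.2.2.2.1, (hK 2).2.2.2.2.1, (hK 3).2.2.2.2.1]
  have hcF : fcount x = cntF (K 0) (K 1) (K 2) (K 3) := by
    simp only [fcount, cntF, (hK 0).2.2.2.2.2, (hK 1).2.2.2.2.2, (hK 2).2.2.2.2.2, (hK 3).2.2.2.2.2]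
  have hcDF : dfcount x = cntDF (K 0) (K 1) (K 2) (K 3) := by
    simp only [dfcount, cntDF, (hK 0).2.2.2.1, (hK 1).2.2.2.1, (hK 2).2.2.2.1, (hK 3).2.2.2.1,
      (hK 0).2.2.2.2.2, (hK 1).2.2.2.2.2, (hK 2).2.2.2.2.2, (hK 3).2.2.2.2.2]
  rw [hG, hcE, hcF, hcDF]
  rw [hcE] at hkE
  rw [hcF] at hkF
  rw [hcDF] at hkDF
  exact chkP5_spec kE kF kDF γ L YE YF YDF hchk _ _ _ _ hkE hkF hkDF

/-- Branch `(kE, kF, kDF)`, N side. -/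
theorem N_bound (kE kF kDF : ℕ) (γ : Coefs) (L : ℤ) (hchk : chkN5 kE kF kDF γ L = true) (y : Cell) (hy : ∀ f, NAdm (y f))
    (hkE : x11count y ≤ kE) (hkF : nbcount y ≤ kF) (hkDF : qnbcount y ≤ kDF) : Gcell γ y ≤ L := by
  have hK : ∀ f, ∃ K, NRep (y f) K := fun f => exists_NRep (hy f)
  choose K hK using hK
  have hG : Gcell γ y = GN5 γ (K 0) (K 1) (K 2) (K 3) := by
    simp only [Gcell, GN5, (hK 0).1, (hK 0).2.1, (hK 1).1, (hK 1).2.1, (hK 2).1, (hK 2).2.1, (hK 3).1, (hK 3).2.1]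
  have hcE : x11count y = cntX11 (K 0) (K 1) (K 2) (K 3) := by
    simp only [x11count, cntX11, (hK 0).2.2.2.1, (hK 1).2.2.2.1, (hK 2).2.2.2.1, (hK 3).2.2.2.1]
  have hcF : nbcount y = cntNB (K 0) (K 1) (K 2) (K 3) := by
    simp only [nbcount, cntNB, (hK 0).2.2.2.2.1, (hK 1).2.2.2.2.1, (hK 2).2.2.2.2.1, (hK 3).2.2.2.2.1]
  have hcDF : qnbcount y = cntQNB (K 0) (K 1) (K 2) (K 3) := by
    simp only [qnbcount, cntQNB, (hK 0).2.2.1, (hK 1).2.2.1, (hK 2).2.2.1, (hK 3).2.2.1,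
      (hK 0).2.2.2.2.1, (hK 1).2.2.2.2.1, (hK 2).2.2.2.2.1, (hK 3).2.2.2.2.1]
  rw [hG]
  rw [hcE] at hkE
  rw [hcF] at hkF
  rw [hcDF] at hkDF
  exact chkN5_spec kE kF kDF γ L hchk _ _ _ _ hkE hkF hkDF

/-- `μ`-branch, P side: `L·|proj ∏β̄| ≤ −G(x)` for every `D`,`F`-free admissible P-cell and every `proj ∈ {re, im}`. -/
theorem P0_bound (γ : Coefs) (L : ℤ) (hL : 0 ≤ L) (hchk : chkP50 γ L = true) (x : Cell) (hx : ∀ f, PAdm (x f))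
    (h0 : dfcount x = 0) (proj : GaussianInt → ℤ) (hproj : ∀ z, proj z ^ 2 ≤ z.norm) :
    L * |proj (cellCoef x Word.eeee)| ≤ -Gcell γ x := by
  have hK : ∀ f, ∃ K, PRep (x f) K := fun f => exists_PRep (hx f)
  choose K hK using hK
  have hG : Gcell γ x = GP5 γ (K 0) (K 1) (K 2) (K 3) := by
    simp only [Gcell, GP5, (hK 0).1, (hK 0).2.1, (hK 1).1, (hK 1).2.1, (hK 2).1, (hK 2).2.1, (hK 3).1, (hK 3).2.1]
  have hcDF : dfcount x = cntDF (K 0) (K 1) (K 2) (K 3) := by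
    simp only [dfcount, cntDF, (hK 0).2.2.2.1, (hK 1).2.2.2.1, (hK 2).2.2.2.1, (hK 3).2.2.2.1,
      (hK 0).2.2.2.2.2, (hK 1).2.2.2.2.2, (hK 2).2.2.2.2.2, (hK 3).2.2.2.2.2]
  have hn : (cellCoef x Word.eeee).norm = (K 0).bv * (K 1).bv * (K 2).bv * (K 3).bv := by
    rw [norm_cellCoef_eeee, (hK 0).2.2.1, (hK 1).2.2.1, (hK 2).2.2.1, (hK 3).2.2.1]
  rw [hcDF] at h0
  obtain ⟨hle, hsq⟩ := chkP50_spec γ L hchk _ _ _ _ h0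
  rw [← hG] at hle hsq
  rw [← hn] at hsq
  have h1 : (L * proj (cellCoef x Word.eeee)) ^ 2 ≤ (-Gcell γ x) ^ 2 := by
    have := hproj (cellCoef x Word.eeee)
    nlinarith
  have h2 := abs_le_of_sq_le_sq h1 (by linarith)
  rwa [abs_mul, abs_of_nonneg hL] at h2

/-- `μ`-branch, N side: `L·|proj ∏β̄| ≤ G(y)` for every `Q`,`NB`-free admissible N-cell. -/
theorem N0_bound (γ : Coefs) (L : ℤ) (hL : 0 ≤ L) (hchk : chkN50 γ L = true) (y : Cell) (hy : ∀ f, NAdm (y f))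
    (h0 : qnbcount y = 0) (proj : GaussianInt → ℤ) (hproj : ∀ z, proj z ^ 2 ≤ z.norm) :
    L * |proj (cellCoef y Word.eeee)| ≤ Gcell γ y := by
  have hK : ∀ f, ∃ K, NRep (y f) K := fun f => exists_NRep (hy f)
  choose K hK using hK
  have hG : Gcell γ y = GN5 γ (K 0) (K 1) (K 2) (K 3) := by
    simp only [Gcell, GN5, (hK 0).1, (hK 0).2.1, (hK 1).1, (hK 1).2.1, (hK 2).1, (hK 2).2.1, (hK 3).1, (hK 3).2.1]
  unfold qnbcount at h0
  have hb0 : (isQ (y 0) || isNB (y 0)) = false := by apply toNat_eq_zero'; omega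
  have hb1 : (isQ (y 1) || isNB (y 1)) = false := by apply toNat_eq_zero'; omega
  have hb2 : (isQ (y 2) || isNB (y 2)) = false := by apply toNat_eq_zero'; omega
  have hb3 : (isQ (y 3) || isNB (y 3)) = false := by apply toNat_eq_zero'; omega
  have hsplit : ∀ f, (isQ (y f) || isNB (y f)) = false → (K f).isQ = false ∧ (K f).isNB = false := fun f hf => by
    rw [(hK f).2.2.1, (hK f).2.2.2.2.1] at hf
    exact Bool.or_eq_false_iff.mp hf
  obtain ⟨hq0, hn0⟩ := hsplit 0 hb0
  obtain ⟨hq1, hn1⟩ := hsplit 1 hb1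
  obtain ⟨hq2, hn2⟩ := hsplit 2 hb2
  obtain ⟨hq3, hn3⟩ := hsplit 3 hb3
  have hc : cntQNB (K 0) (K 1) (K 2) (K 3) = 0 := by simp [cntQNB, hq0, hn0, hq1, hn1, hq2, hn2, hq3, hn3]
  have hn : (cellCoef y Word.eeee).norm = ((K 0).sv * (K 1).sv * (K 2).sv * (K 3).sv) ^ 2 := by
    rw [norm_cellCoef_eeee, (hK 0).2.2.2.2.2 hq0 hn0, (hK 1).2.2.2.2.2 hq1 hn1, (hK 2).2.2.2.2.2 hq2 hn2,
      (hK 3).2.2.2.2.2 hq3 hn3]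
    ring
  have hs : 0 ≤ (K 0).sv * (K 1).sv * (K 2).sv * (K 3).sv :=
    mul_nonneg (mul_nonneg (mul_nonneg (NC5.sv_nonneg _) (NC5.sv_nonneg _)) (NC5.sv_nonneg _)) (NC5.sv_nonneg _)
  have hle := chkN50_spec γ L hchk _ _ _ _ hc
  rw [← hG] at hle
  have h1 : proj (cellCoef y Word.eeee) ^ 2 ≤ ((K 0).sv * (K 1).sv * (K 2).sv * (K 3).sv) ^ 2 := by
    rw [← hn]; exact hproj _
  have h2 := abs_le_of_sq_le_sq h1 hs
  calc L * |proj (cellCoef y Word.eeee)| ≤ L * ((K 0).sv * (K 1).sv * (K 2).sv * (K 3).sv) :=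
        mul_le_mul_of_nonneg_left h2 hL
    _ ≤ Gcell γ y := hle

/-! ## §6 Designs: admissibility of supported letters, the three maxima, the two branch theorems -/

theorem P_adm (D : Design) (hA : D.OnAlphabet 14) (h4 : D.A4)
    (hc : ∀ c ∈ D.suppN ++ D.suppP, ∀ f : Fin 4, (c f).colevel ≤ 5) : ∀ x ∈ D.suppP, ∀ f, PAdm (x f) := by
  intro x hx f
  obtain ⟨y, hy, hlive⟩ := h4.1 x hx
  have hxA : (x f).OnAlphabet 14 := hA x (List.mem_append.mpr (Or.inr hx)) f
  have hyA : (y f).OnAlphabet 14 := hA y (List.mem_append.mpr (Or.inl hy)) f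
  have hnotaxis : ¬ (x f).isAxis := fun hax =>
    no_ample_cover_of_axis (x f) (y f) (hxA.1.trans hyA.1.symm) hax (hlive f)
  unfold Letter.isAxis at hnotaxis
  have hxx : (x f).x ≠ 0 := fun h0 => hnotaxis (by rw [h0]; ring)
  have hxy : (x f).y ≠ 0 := fun h0 => hnotaxis (by rw [h0]; ring)
  exact ⟨hxA, hc x (List.mem_append.mpr (Or.inr hx)) f, hxx, hxy⟩

theorem N_adm (D : Design) (hA : D.OnAlphabet 14) (h4 : D.A4)
    (hc : ∀ c ∈ D.suppN ++ D.suppP, ∀ f : Fin 4, (c f).colevel ≤ 5) : ∀ y ∈ D.suppN, ∀ f, NAdm (y f) := by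
  intro y hy f
  obtain ⟨x, hx, hlive⟩ := h4.2 y hy
  have hxA : (x f).OnAlphabet 14 := hA x (List.mem_append.mpr (Or.inr hx)) f
  have hyA : (y f).OnAlphabet 14 := hA y (List.mem_append.mpr (Or.inl hy)) f
  have hdrop := colevel_drop_two (x f) (y f) (hxA.1.trans hyA.1.symm) (hlive f)
  have hcx := hc x (List.mem_append.mpr (Or.inr hx)) f
  exact ⟨hyA, by linarith⟩

theorem N_counts (D : Design) (hA : D.OnAlphabet 14) (h4 : D.A4)
    (hc : ∀ c ∈ D.suppN ++ D.suppP, ∀ f : Fin 4, (c f).colevel ≤ 5) :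
    ∀ y ∈ D.suppN, ∃ x ∈ D.suppP, x11count y ≤ ecount x ∧ nbcount y ≤ fcount x ∧ qnbcount y ≤ dfcount x := by
  intro y hy
  obtain ⟨x, hx, hlive⟩ := h4.2 y hy
  exact ⟨x, hx, counts_le_of_live (P_adm D hA h4 hc x hx) hlive⟩

theorem mu_zero_of_suppP_nil (D : Design) (h4 : D.A4) (hnil : D.suppP = []) : D.mu = 0 := by
  have hPzero : ∀ cm ∈ D.P, cm.2 = 0 := by
    intro cm hcm
    by_contra hne
    have hmem : cm.1 ∈ D.suppP := (mem_suppP_iff D cm.1).mpr ⟨cm.2, by simpa using hcm, Nat.pos_of_ne_zero hne⟩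
    rw [hnil] at hmem
    simp at hmem
  have hNzero : ∀ cm ∈ D.N, cm.2 = 0 := by
    intro cm hcm
    by_contra hne
    have hmem : cm.1 ∈ D.suppN := (mem_suppN_iff D cm.1).mpr ⟨cm.2, by simpa using hcm, Nat.pos_of_ne_zero hne⟩
    obtain ⟨x, hx, _⟩ := h4.2 cm.1 hmem
    rw [hnil] at hx
    simp at hx
  have hN0 := wsum_eq_zero_of_mults_zero D.N (fun c => cellCoef c Word.eeee) hNzero
  have hP0 := wsum_eq_zero_of_mults_zero D.P (fun c => cellCoef c Word.eeee) hPzero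
  unfold Design.mu Design.T
  rw [hN0, hP0]
  simp

/-- one cover term: `Y·[count = k]` summed over `D.P` is `≥ Y` when attained by a supported cell, and `≥ 0` always. -/
theorem cover_term_ge (D : Design) (cnt : Cell → ℕ) (k : ℕ) (Y : ℤ) (hY : 0 ≤ Y)
    (hatt : Y = 0 ∨ ∃ x ∈ D.suppP, cnt x = k) :
    Y ≤ Y * linZ D.P (fun c => if cnt c = k then 1 else 0) := by
  have hind0 : ∀ c, 0 ≤ (if cnt c = k then (1 : ℤ) else 0) := fun c => by split <;> norm_num
  rcases hatt with h0 | ⟨x₀, hx₀, hk₀⟩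
  · rw [h0]; simp
  · obtain ⟨m₀, hm₀, hpos₀⟩ := (mem_suppP_iff D x₀).mp hx₀
    have hind1 := term_le_linZ D.P _ hind0 x₀ m₀ hm₀
    have hx1 : (if cnt x₀ = k then (1 : ℤ) else 0) = 1 := by rw [if_pos hk₀]
    rw [hx1, mul_one] at hind1
    have hm1 : (1 : ℤ) ≤ m₀ := by exact_mod_cast hpos₀
    nlinarith

/-- **Branch `(kE, kF, kDF)`.** With the three maxima bounding every supported cell's counts and a certificate passing `chkN5`∕`chkP5`,
each cover multiplier that is attained (or zero) is paid for: `YE + YF + YDF ≤ L·M`. -/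
theorem branch_pos (D : Design) (h1 : D.A1) (hP : ∀ x ∈ D.suppP, ∀ f, PAdm (x f)) (hN : ∀ y ∈ D.suppN, ∀ f, NAdm (y f))
    (kE kF kDF : ℕ)
    (hPE : ∀ x ∈ D.suppP, ecount x ≤ kE) (hPF : ∀ x ∈ D.suppP, fcount x ≤ kF) (hPDF : ∀ x ∈ D.suppP, dfcount x ≤ kDF)
    (hNE : ∀ y ∈ D.suppN, x11count y ≤ kE) (hNF : ∀ y ∈ D.suppN, nbcount y ≤ kF) (hNDF : ∀ y ∈ D.suppN, qnbcount y ≤ kDF)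
    (γ : Coefs) (L YE YF YDF : ℤ) (hYE : 0 ≤ YE) (hYF : 0 ≤ YF) (hYDF : 0 ≤ YDF)
    (hattE : YE = 0 ∨ ∃ x ∈ D.suppP, ecount x = kE) (hattF : YF = 0 ∨ ∃ x ∈ D.suppP, fcount x = kF)
    (hattDF : YDF = 0 ∨ ∃ x ∈ D.suppP, dfcount x = kDF)
    (hcN : chkN5 kE kF kDF γ L = true) (hcP : chkP5 kE kF kDF γ L YE YF YDF = true) :
    YE + YF + YDF ≤ L * (D.copies : ℤ) := by
  let iE : Cell → ℤ := fun c => if ecount c = kE then 1 else 0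
  let iF : Cell → ℤ := fun c => if fcount c = kF then 1 else 0
  let iDF : Cell → ℤ := fun c => if dfcount c = kDF then 1 else 0
  have hNle : linZ D.N (Gcell γ) ≤ L * ((D.N.map Prod.snd).sum : ℕ) := by
    refine linZ_le_mul_sum D.N (Gcell γ) L fun cm hcm hpos => ?_
    have hmem : cm.1 ∈ D.suppN := (mem_suppN_iff D cm.1).mpr ⟨cm.2, by simpa using hcm, hpos⟩
    exact N_bound kE kF kDF γ L hcN cm.1 (hN cm.1 hmem) (hNE cm.1 hmem) (hNF cm.1 hmem) (hNDF cm.1 hmem)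
  have hPle : linZ D.P (fun c => (-1) * Gcell γ c + (YE * iE c + (YF * iF c + YDF * iDF c)))
      ≤ L * ((D.P.map Prod.snd).sum : ℕ) := by
    refine linZ_le_mul_sum D.P _ L fun cm hcm hpos => ?_
    have hmem : cm.1 ∈ D.suppP := (mem_suppP_iff D cm.1).mpr ⟨cm.2, by simpa using hcm, hpos⟩
    have := P_bound kE kF kDF γ L YE YF YDF hcP cm.1 (hP cm.1 hmem) (hPE cm.1 hmem) (hPF cm.1 hmem) (hPDF cm.1 hmem)
    show (-1) * Gcell γ cm.1 + (YE * iE cm.1 + (YF * iF cm.1 + YDF * iDF cm.1)) ≤ L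
    linarith
  have hsplit : linZ D.P (fun c => (-1) * Gcell γ c + (YE * iE c + (YF * iF c + YDF * iDF c)))
      = (-1) * linZ D.P (Gcell γ) + (YE * linZ D.P iE + (YF * linZ D.P iF + YDF * linZ D.P iDF)) := by
    rw [linZ_add, linZ_smul, linZ_add, linZ_smul, linZ_add, linZ_smul, linZ_smul]
  have hvan := G_vanishes D h1 γ
  have hE' := cover_term_ge D ecount kE YE hYE hattE
  have hF' := cover_term_ge D fcount kF YF hYF hattF
  have hDF' := cover_term_ge D dfcount kDF YDF hYDF hattDF
  unfold Design.copies
  rw [Nat.cast_add]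
  rw [hsplit] at hPle
  change YE ≤ YE * linZ D.P iE at hE'
  change YF ≤ YF * linZ D.P iF at hF'
  change YDF ≤ YDF * linZ D.P iDF at hDF'
  linarith

/-- **`μ`-branch.** If no supported P-cell has a `D` or `F` slot (hence no supported N-cell a `Q` or `NB` slot), a certificate `(γ, L)`
with `L > 0` passing `chkN50`∕`chkP50` forces `μ = 0`. -/
theorem branch_zero (D : Design) (h1 : D.A1) (hP : ∀ x ∈ D.suppP, ∀ f, PAdm (x f)) (hN : ∀ y ∈ D.suppN, ∀ f, NAdm (y f))
    (hmaxP : ∀ x ∈ D.suppP, dfcount x = 0) (hmaxN : ∀ y ∈ D.suppN, qnbcount y = 0)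
    (γ : Coefs) (L : ℤ) (hL : 0 < L) (hcN : chkN50 γ L = true) (hcP : chkP50 γ L = true) : D.mu = 0 := by
  have key : ∀ proj : GaussianInt → ℤ, (∀ z, proj z ^ 2 ≤ z.norm) →
      (proj D.mu = linZ D.N (fun c => proj (cellCoef c Word.eeee)) - linZ D.P (fun c => proj (cellCoef c Word.eeee))) →
      proj D.mu = 0 := by
    intro proj hproj hmu
    have hNpt : ∀ cm ∈ D.N, 0 < cm.2 → L * |proj (cellCoef cm.1 Word.eeee)| ≤ Gcell γ cm.1 := by
      intro cm hcm hpos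
      have hmem : cm.1 ∈ D.suppN := (mem_suppN_iff D cm.1).mpr ⟨cm.2, by simpa using hcm, hpos⟩
      exact N0_bound γ L hL.le hcN cm.1 (hN cm.1 hmem) (hmaxN cm.1 hmem) proj hproj
    have hPpt : ∀ cm ∈ D.P, 0 < cm.2 → L * |proj (cellCoef cm.1 Word.eeee)| ≤ (-1) * Gcell γ cm.1 := by
      intro cm hcm hpos
      have hmem : cm.1 ∈ D.suppP := (mem_suppP_iff D cm.1).mpr ⟨cm.2, by simpa using hcm, hpos⟩
      have := P0_bound γ L hL.le hcP cm.1 (hP cm.1 hmem) (hmaxP cm.1 hmem) proj hproj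
      linarith
    have hN' : L * linZ D.N (fun c => |proj (cellCoef c Word.eeee)|) ≤ linZ D.N (Gcell γ) := by
      rw [← linZ_smul]; exact linZ_mono _ _ _ hNpt
    have hP' : L * linZ D.P (fun c => |proj (cellCoef c Word.eeee)|) ≤ (-1) * linZ D.P (Gcell γ) := by
      rw [← linZ_smul, ← linZ_smul]; exact linZ_mono _ _ _ hPpt
    have habs : |proj D.mu| ≤ linZ D.N (fun c => |proj (cellCoef c Word.eeee)|)
        + linZ D.P (fun c => |proj (cellCoef c Word.eeee)|) := by
      rw [hmu]
      calc |linZ D.N (fun c => proj (cellCoef c Word.eeee)) - linZ D.P (fun c => proj (cellCoef c Word.eeee))|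
          ≤ |linZ D.N (fun c => proj (cellCoef c Word.eeee))| + |linZ D.P (fun c => proj (cellCoef c Word.eeee))| :=
            abs_sub _ _
        _ ≤ _ := add_le_add (abs_linZ_le _ _) (abs_linZ_le _ _)
    have hvan := G_vanishes D h1 γ
    have hfin : L * |proj D.mu| ≤ 0 := by nlinarith
    have habs0 : |proj D.mu| ≤ 0 := by
      have h' : L * |proj D.mu| ≤ L * 0 := by rw [mul_zero]; exact hfin
      exact le_of_mul_le_mul_left h' hL
    exact abs_eq_zero.mp (le_antisymm habs0 (abs_nonneg _))
  have hre : D.mu.re = 0 := key Zsqrtd.re re_sq_le_norm (by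
    unfold Design.mu; rw [T_eq_linG, Zsqrtd.re_sub, re_linG, re_linG])
  have him : D.mu.im = 0 := key Zsqrtd.im im_sq_le_norm (by
    unfold Design.mu; rw [T_eq_linG, Zsqrtd.im_sub, im_linG, im_linG])
  exact Zsqrtd.ext hre him

/-! ## §7 RING 5 IS EMPTY -/

/-- **RING 5 IS EMPTY** (kernel): on the height-14 alphabet there is no (A1)-clean (A4) design with `μ ≠ 0`, all supported letters of
co-level `≤ 5`, and copy count `M ≤ B`, for any `B ≤ 199` and any rank floor (the rank hypothesis is idle).  Knife-edge: branch
`(kE, kF, kDF) = (1, 3, 4)` has LP value `1110065∕5576 ≈ 199.079`, so `B = 200` is NOT covered by these certificates. -/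
theorem ringsEmpty_colevel_five (B : ℕ) (hB : B ≤ 199) (rmin : ℤ) : RingsEmpty 14 B rmin 5 := by
  intro D hA h1 h4 hμ hcop _ hc
  have hP := P_adm D hA h4 hc
  have hN := N_adm D hA h4 hc
  have hNC := N_counts D hA h4 hc
  by_cases hnil : D.suppP = []
  · exact hμ (mu_zero_of_suppP_nil D h4 hnil)
  have hne : D.suppP.toFinset.Nonempty := by
    rw [Finset.nonempty_iff_ne_empty, Ne, List.toFinset_eq_empty_iff]
    exact hnil
  -- the three maxima
  obtain ⟨xE, hxE', hmaxE'⟩ := D.suppP.toFinset.exists_max_image ecount hne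
  obtain ⟨xF, hxF', hmaxF'⟩ := D.suppP.toFinset.exists_max_image fcount hne
  obtain ⟨xDF, hxDF', hmaxDF'⟩ := D.suppP.toFinset.exists_max_image dfcount hne
  have hxE : xE ∈ D.suppP := List.mem_toFinset.mp hxE'
  have hxF : xF ∈ D.suppP := List.mem_toFinset.mp hxF'
  have hxDF : xDF ∈ D.suppP := List.mem_toFinset.mp hxDF'
  have hPE : ∀ x ∈ D.suppP, ecount x ≤ ecount xE := fun x hx => hmaxE' x (List.mem_toFinset.mpr hx)
  have hPF : ∀ x ∈ D.suppP, fcount x ≤ fcount xF := fun x hx => hmaxF' x (List.mem_toFinset.mpr hx)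
  have hPDF : ∀ x ∈ D.suppP, dfcount x ≤ dfcount xDF := fun x hx => hmaxDF' x (List.mem_toFinset.mpr hx)
  have hNE : ∀ y ∈ D.suppN, x11count y ≤ ecount xE := fun y hy => by
    obtain ⟨x, hx, h⟩ := hNC y hy; exact le_trans h.1 (hPE x hx)
  have hNF : ∀ y ∈ D.suppN, nbcount y ≤ fcount xF := fun y hy => by
    obtain ⟨x, hx, h⟩ := hNC y hy; exact le_trans h.2.1 (hPF x hx)
  have hNDF : ∀ y ∈ D.suppN, qnbcount y ≤ dfcount xDF := fun y hy => by
    obtain ⟨x, hx, h⟩ := hNC y hy; exact le_trans h.2.2 (hPDF x hx)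
  have hattE : ∃ x ∈ D.suppP, ecount x = ecount xE := ⟨xE, hxE, rfl⟩
  have hattF : ∃ x ∈ D.suppP, fcount x = fcount xF := ⟨xF, hxF, rfl⟩
  have hattDF : ∃ x ∈ D.suppP, dfcount x = dfcount xDF := ⟨xDF, hxDF, rfl⟩
  have hcopZ : (D.copies : ℤ) ≤ 199 := by exact_mod_cast le_trans hcop hB
  have hE4 := ecount_le_four xE
  have hF4 := fcount_le_four xF
  have hDF4 := dfcount_le_four xDF
  have hFDF : fcount xF ≤ dfcount xDF := le_trans (fcount_le_dfcount xF) (hPDF xF hxF)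
  -- every supported P-cell has ecount ≤ 4 trivially; use kE = 4 for the E-free certificates
  have hPE4 : ∀ x ∈ D.suppP, ecount x ≤ 4 := fun x _ => ecount_le_four x
  have hNE4 : ∀ y ∈ D.suppN, x11count y ≤ 4 := fun y hy => le_trans (hNE y hy) hE4
  -- case split on (kF, kDF); the branch (3, 4) further on kE
  rcases (show fcount xF = 0 ∨ fcount xF = 1 ∨ fcount xF = 2 ∨ fcount xF = 3 ∨ fcount xF = 4 by omega) with
    hkF | hkF | hkF | hkF | hkF
  · -- kF = 0
    rcases (show dfcount xDF = 0 ∨ dfcount xDF = 1 ∨ dfcount xDF = 2 ∨ dfcount xDF = 3 ∨ dfcount xDF = 4 by omega) with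
      hkDF | hkDF | hkDF | hkDF | hkDF
    · -- (kF, kDF) = (0, 0)
      exact hμ (branch_zero D h1 hP hN (fun x hx => by have := hPDF x hx; omega)
        (fun y hy => by have := hNDF y hy; omega) γmu 3011568 (by norm_num) chkN_mu chkP_mu)
    · -- (kF, kDF) = (0, 1)
      have hb := branch_pos D h1 hP hN 4 0 1 hPE4 (fun x hx => (hPF x hx).trans hkF.le) (fun x hx => (hPDF x hx).trans hkDF.le) hNE4 (fun y hy => (hNF y hy).trans hkF.le) (fun y hy => (hNDF y hy).trans hkDF.le)
        γx01 0 0 0 234240 le_rfl (by norm_num) (by norm_num) (Or.inl rfl) (Or.inr ⟨xF, hxF, hkF⟩) (Or.inr ⟨xDF, hxDF, hkDF⟩)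
        chkN_x01 chkP_x01
      linarith
    · -- (kF, kDF) = (0, 2)
      have hb := branch_pos D h1 hP hN 4 0 2 hPE4 (fun x hx => (hPF x hx).trans hkF.le) (fun x hx => (hPDF x hx).trans hkDF.le) hNE4 (fun y hy => (hNF y hy).trans hkF.le) (fun y hy => (hNDF y hy).trans hkDF.le)
        γx02 24 0 0 29232 le_rfl (by norm_num) (by norm_num) (Or.inl rfl) (Or.inr ⟨xF, hxF, hkF⟩) (Or.inr ⟨xDF, hxDF, hkDF⟩)
        chkN_x02 chkP_x02
      linarith
    · -- (kF, kDF) = (0, 3)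
      have hb := branch_pos D h1 hP hN 4 0 3 hPE4 (fun x hx => (hPF x hx).trans hkF.le) (fun x hx => (hPDF x hx).trans hkDF.le) hNE4 (fun y hy => (hNF y hy).trans hkF.le) (fun y hy => (hNDF y hy).trans hkDF.le)
        γx03 9720 0 0 8744400 le_rfl (by norm_num) (by norm_num) (Or.inl rfl) (Or.inr ⟨xF, hxF, hkF⟩) (Or.inr ⟨xDF, hxDF, hkDF⟩)
        chkN_x03 chkP_x03
      linarith
    · -- (kF, kDF) = (0, 4)
      have hb := branch_pos D h1 hP hN 4 0 4 hPE4 (fun x hx => (hPF x hx).trans hkF.le) (fun x hx => (hPDF x hx).trans hkDF.le) hNE4 (fun y hy => (hNF y hy).trans hkF.le) (fun y hy => (hNDF y hy).trans hkDF.le)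
        γx04 7776 0 0 15627360 le_rfl (by norm_num) (by norm_num) (Or.inl rfl) (Or.inr ⟨xF, hxF, hkF⟩) (Or.inr ⟨xDF, hxDF, hkDF⟩)
        chkN_x04 chkP_x04
      linarith
  · -- kF = 1
    rcases (show dfcount xDF = 0 ∨ dfcount xDF = 1 ∨ dfcount xDF = 2 ∨ dfcount xDF = 3 ∨ dfcount xDF = 4 by omega) with
      hkDF | hkDF | hkDF | hkDF | hkDF
    · -- (kF, kDF) = (1, 0)
      exfalso; omega
    · -- (kF, kDF) = (1, 1)
      have hb := branch_pos D h1 hP hN 4 1 1 hPE4 (fun x hx => (hPF x hx).trans hkF.le) (fun x hx => (hPDF x hx).trans hkDF.le) hNE4 (fun y hy => (hNF y hy).trans hkF.le) (fun y hy => (hNDF y hy).trans hkDF.le)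
        γx11 0 0 200112 587352 le_rfl (by norm_num) (by norm_num) (Or.inl rfl) (Or.inr ⟨xF, hxF, hkF⟩) (Or.inr ⟨xDF, hxDF, hkDF⟩)
        chkN_x11 chkP_x11
      linarith
    · -- (kF, kDF) = (1, 2)
      have hb := branch_pos D h1 hP hN 4 1 2 hPE4 (fun x hx => (hPF x hx).trans hkF.le) (fun x hx => (hPDF x hx).trans hkDF.le) hNE4 (fun y hy => (hNF y hy).trans hkF.le) (fun y hy => (hNDF y hy).trans hkDF.le)
        γx12 3072 0 352240 996544 le_rfl (by norm_num) (by norm_num) (Or.inl rfl) (Or.inr ⟨xF, hxF, hkF⟩) (Or.inr ⟨xDF, hxDF, hkDF⟩)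
        chkN_x12 chkP_x12
      linarith
    · -- (kF, kDF) = (1, 3)
      have hb := branch_pos D h1 hP hN 4 1 3 hPE4 (fun x hx => (hPF x hx).trans hkF.le) (fun x hx => (hPDF x hx).trans hkDF.le) hNE4 (fun y hy => (hNF y hy).trans hkF.le) (fun y hy => (hNDF y hy).trans hkDF.le)
        γx13 1679616 0 67354668 474933504 le_rfl (by norm_num) (by norm_num) (Or.inl rfl) (Or.inr ⟨xF, hxF, hkF⟩) (Or.inr ⟨xDF, hxDF, hkDF⟩)
        chkN_x13 chkP_x13
      linarith
    · -- (kF, kDF) = (1, 4)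
      have hb := branch_pos D h1 hP hN 4 1 4 hPE4 (fun x hx => (hPF x hx).trans hkF.le) (fun x hx => (hPDF x hx).trans hkDF.le) hNE4 (fun y hy => (hNF y hy).trans hkF.le) (fun y hy => (hNDF y hy).trans hkDF.le)
        γx14 635040 0 8929488 350813856 le_rfl (by norm_num) (by norm_num) (Or.inl rfl) (Or.inr ⟨xF, hxF, hkF⟩) (Or.inr ⟨xDF, hxDF, hkDF⟩)
        chkN_x14 chkP_x14
      linarith
  · -- kF = 2
    rcases (show dfcount xDF = 0 ∨ dfcount xDF = 1 ∨ dfcount xDF = 2 ∨ dfcount xDF = 3 ∨ dfcount xDF = 4 by omega) with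
      hkDF | hkDF | hkDF | hkDF | hkDF
    · -- (kF, kDF) = (2, 0)
      exfalso; omega
    · -- (kF, kDF) = (2, 1)
      exfalso; omega
    · -- (kF, kDF) = (2, 2)
      have hb := branch_pos D h1 hP hN 4 2 2 hPE4 (fun x hx => (hPF x hx).trans hkF.le) (fun x hx => (hPDF x hx).trans hkDF.le) hNE4 (fun y hy => (hNF y hy).trans hkF.le) (fun y hy => (hNDF y hy).trans hkDF.le)
        γx22 384 0 135656 0 le_rfl (by norm_num) (by norm_num) (Or.inl rfl) (Or.inr ⟨xF, hxF, hkF⟩) (Or.inr ⟨xDF, hxDF, hkDF⟩)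
        chkN_x22 chkP_x22
      linarith
    · -- (kF, kDF) = (2, 3)
      have hb := branch_pos D h1 hP hN 4 2 3 hPE4 (fun x hx => (hPF x hx).trans hkF.le) (fun x hx => (hPDF x hx).trans hkDF.le) hNE4 (fun y hy => (hNF y hy).trans hkF.le) (fun y hy => (hNDF y hy).trans hkDF.le)
        γx23 24576 0 2634344 4124544 le_rfl (by norm_num) (by norm_num) (Or.inl rfl) (Or.inr ⟨xF, hxF, hkF⟩) (Or.inr ⟨xDF, hxDF, hkDF⟩)
        chkN_x23 chkP_x23
      linarith
    · -- (kF, kDF) = (2, 4)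
      have hb := branch_pos D h1 hP hN 4 2 4 hPE4 (fun x hx => (hPF x hx).trans hkF.le) (fun x hx => (hPDF x hx).trans hkDF.le) hNE4 (fun y hy => (hNF y hy).trans hkF.le) (fun y hy => (hNDF y hy).trans hkDF.le)
        γx24 2801952 0 89127952 586497312 le_rfl (by norm_num) (by norm_num) (Or.inl rfl) (Or.inr ⟨xF, hxF, hkF⟩) (Or.inr ⟨xDF, hxDF, hkDF⟩)
        chkN_x24 chkP_x24
      linarith
  · -- kF = 3
    rcases (show dfcount xDF = 0 ∨ dfcount xDF = 1 ∨ dfcount xDF = 2 ∨ dfcount xDF = 3 ∨ dfcount xDF = 4 by omega) with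
      hkDF | hkDF | hkDF | hkDF | hkDF
    · -- (kF, kDF) = (3, 0)
      exfalso; omega
    · -- (kF, kDF) = (3, 1)
      exfalso; omega
    · -- (kF, kDF) = (3, 2)
      exfalso; omega
    · -- (kF, kDF) = (3, 3)
      have hb := branch_pos D h1 hP hN 4 3 3 hPE4 (fun x hx => (hPF x hx).trans hkF.le) (fun x hx => (hPDF x hx).trans hkDF.le) hNE4 (fun y hy => (hNF y hy).trans hkF.le) (fun y hy => (hNDF y hy).trans hkDF.le)
        γx33 1608768 0 409918368 0 le_rfl (by norm_num) (by norm_num) (Or.inl rfl) (Or.inr ⟨xF, hxF, hkF⟩) (Or.inr ⟨xDF, hxDF, hkDF⟩)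
        chkN_x33 chkP_x33
      linarith
    · -- (kF, kDF) = (3, 4)
      rcases (show ecount xE = 0 ∨ ecount xE = 1 ∨ ecount xE = 2 ∨ ecount xE = 3 ∨ ecount xE = 4 by omega) with
        hkE | hkE | hkE | hkE | hkE
      · -- kE = 0
        have hb := branch_pos D h1 hP hN 0 3 4 (fun x hx => (hPE x hx).trans hkE.le) (fun x hx => (hPF x hx).trans hkF.le) (fun x hx => (hPDF x hx).trans hkDF.le)
          (fun y hy => (hNE y hy).trans hkE.le) (fun y hy => (hNF y hy).trans hkF.le) (fun y hy => (hNDF y hy).trans hkDF.le) γ034 106944 0 8689356 13353408 (by norm_num) (by norm_num) (by norm_num)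
          (Or.inr ⟨xE, hxE, hkE⟩) (Or.inr ⟨xF, hxF, hkF⟩) (Or.inr ⟨xDF, hxDF, hkDF⟩) chkN_034 chkP_034
        linarith
      · -- kE = 1
        have hb := branch_pos D h1 hP hN 1 3 4 (fun x hx => (hPE x hx).trans hkE.le) (fun x hx => (hPF x hx).trans hkF.le) (fun x hx => (hPDF x hx).trans hkDF.le)
          (fun y hy => (hNE y hy).trans hkE.le) (fun y hy => (hNF y hy).trans hkF.le) (fun y hy => (hNDF y hy).trans hkDF.le) γ134 133824 3312 10347240 16291008 (by norm_num) (by norm_num) (by norm_num)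
          (Or.inr ⟨xE, hxE, hkE⟩) (Or.inr ⟨xF, hxF, hkF⟩) (Or.inr ⟨xDF, hxDF, hkDF⟩) chkN_134 chkP_134
        linarith
      · -- kE = 2
        have hb := branch_pos D h1 hP hN 2 3 4 (fun x hx => (hPE x hx).trans hkE.le) (fun x hx => (hPF x hx).trans hkF.le) (fun x hx => (hPDF x hx).trans hkDF.le)
          (fun y hy => (hNE y hy).trans hkE.le) (fun y hy => (hNF y hy).trans hkF.le) (fun y hy => (hNDF y hy).trans hkDF.le) γ234 1833024 7353360 140217384 220115520 (by norm_num) (by norm_num) (by norm_num)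
          (Or.inr ⟨xE, hxE, hkE⟩) (Or.inr ⟨xF, hxF, hkF⟩) (Or.inr ⟨xDF, hxDF, hkDF⟩) chkN_234 chkP_234
        linarith
      · -- kE = 3
        have hb := branch_pos D h1 hP hN 3 3 4 (fun x hx => (hPE x hx).trans hkE.le) (fun x hx => (hPF x hx).trans hkF.le) (fun x hx => (hPDF x hx).trans hkDF.le)
          (fun y hy => (hNE y hy).trans hkE.le) (fun y hy => (hNF y hy).trans hkF.le) (fun y hy => (hNDF y hy).trans hkDF.le) γ334 145440 4363200 10922520 17430048 (by norm_num) (by norm_num) (by norm_num)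
          (Or.inr ⟨xE, hxE, hkE⟩) (Or.inr ⟨xF, hxF, hkF⟩) (Or.inr ⟨xDF, hxDF, hkDF⟩) chkN_334 chkP_334
        linarith
      · -- kE = 4
        have hb := branch_pos D h1 hP hN 4 3 4 (fun x hx => (hPE x hx).trans hkE.le) (fun x hx => (hPF x hx).trans hkF.le) (fun x hx => (hPDF x hx).trans hkDF.le)
          (fun y hy => (hNE y hy).trans hkE.le) (fun y hy => (hNF y hy).trans hkF.le) (fun y hy => (hNDF y hy).trans hkDF.le) γ434 4986036 930783528 363329016 591150708 (by norm_num) (by norm_num) (by norm_num)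
          (Or.inr ⟨xE, hxE, hkE⟩) (Or.inr ⟨xF, hxF, hkF⟩) (Or.inr ⟨xDF, hxDF, hkDF⟩) chkN_434 chkP_434
        linarith
  · -- kF = 4
    rcases (show dfcount xDF = 0 ∨ dfcount xDF = 1 ∨ dfcount xDF = 2 ∨ dfcount xDF = 3 ∨ dfcount xDF = 4 by omega) with
      hkDF | hkDF | hkDF | hkDF | hkDF
    · -- (kF, kDF) = (4, 0)
      exfalso; omega
    · -- (kF, kDF) = (4, 1)
      exfalso; omega
    · -- (kF, kDF) = (4, 2)
      exfalso; omega
    · -- (kF, kDF) = (4, 3)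
      exfalso; omega
    · -- (kF, kDF) = (4, 4)
      have hb := branch_pos D h1 hP hN 4 4 4 hPE4 (fun x hx => (hPF x hx).trans hkF.le) (fun x hx => (hPDF x hx).trans hkDF.le) hNE4 (fun y hy => (hNF y hy).trans hkF.le) (fun y hy => (hNDF y hy).trans hkDF.le)
        γx44 2993760 0 754078848 0 le_rfl (by norm_num) (by norm_num) (Or.inl rfl) (Or.inr ⟨xF, hxF, hkF⟩) (Or.inr ⟨xDF, hxDF, hkDF⟩)
        chkN_x44 chkP_x44
      linarith

/-- The instance of record: **`RingsEmpty 14 199 8 5`**. -/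
theorem ringsEmpty_14_199_8_5 : RingsEmpty 14 199 8 5 := ringsEmpty_colevel_five 199 le_rfl 8

/-- Leg A assembled at `c₀ = 5` (director l.8748: «`DepthBound 14 199 8 c₀ ∧ RingsEmpty 14 199 8 c₀` for some `c₀ ≤ 5`»): the FALLBACK
target `DepthBound 14 199 8 5` ALONE now closes the widened (A4) road at `M ≤ 199`, `r ≥ 8`. -/
theorem a4_closed_of_depthBound_five (hd : DepthBound 14 199 8 5) :
    ∀ D : Design, D.OnAlphabet 14 → D.A1 → D.A4 → D.mu ≠ 0 → D.copies ≤ 199 → 8 ≤ D.rank → False :=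
  a4_closed_of_depthBound_and_rings 14 199 8 5 hd ringsEmpty_14_199_8_5

/-- … and the registered stub's statement `DepthBound 14 199 8 3` implies the relaxed target. -/
theorem depthBound_five_of_three (hd : DepthBound 14 199 8 3) : DepthBound 14 199 8 5 :=
  depthBound_mono 14 199 199 8 8 3 5 le_rfl le_rfl (by norm_num) hd

end Summit.HodgeConjecture.HodgeConjecture.Cruxes.BlochSeedDiscOne.RingFiveEmpty
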